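import Summits.CriticalPhenomena.SAWScalingLimit.Cruxes.MassRatio.DisproofAnyCut

/-!
# Disproof companion (cycle 4, §M): `Preconnected` IS DECORATION — component restriction, half-ball linkage, compact connected hulls

Companion workfile of `Cruxes/MassRatio/Disproof.lean` (refuter, `cdisprove`, crux `MassRatio` =
stmt-CriticalPhenomena-8550); imports `DisproofAnyCut`. The cycle-4 headline "`Preconnected` is
decoration modulo the rest of the frame" is an ARGUMENT; this file machine-checks its combinatorial
half (Blocks 1–3) and the assembly modulo the two GEOMETRIC blocks stated as propositions (`RowsComp`,
`ExhaustsComp`), and then DISCHARGES BOTH (§M.5–M.8): `Preconnected` is decoration, unconditionally; no `sorry` anywhere.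

* Block 1 — `comp Λ w` (the `Λ`-component of `w`), `Linked.induct`, `linked_comp`,
  `preconnected_comp`, `verts_linked` (a walk from a root mid-edge `s(u,w)`, `u ∉ Λ`, stays in the
  component of `w`), `observable_comp_eq` (**the observable from `s(u,w)` is the same on `Λ` and on
  `comp Λ w`, every `x, σ, z`**).
* Block 2 — `simplyConnected_comp`: simple connectivity (connected complement) passes to the component.
* Block 3 — `root_mem_boundary_comp`, `target_mem_boundary_comp`, `nonempty_saw_comp`: boundary
  mid-edges and the SAW pass to the component.
* Block 4 — DISCHARGED (§M.5–M.6): `halfball_linked` (linkage of the discrete half-ball `{row ≥ m} ∩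
  B(c,ρ)` inside any `S` satisfying the rows clause, for `10δ ≤ ρ` and float height `η ∈ (0, ρ/2]`:
  high-type vertex → horizontal step towards `Re c`, low-type of row `> m` → down, row `m` → inward steps to
  the central window `|X| ≤ η + 2δ`, a run inside the ball) and **`rowsComp_holds : RowsComp`** (the endpoint
  of `b_δ` supplies `η_δ` and is linked to the root by the SAW).
* Block 5 — DISCHARGED (§M.7–M.8): `exists_vertex_near` (lattice density), `linked_box` / `dist_box_le`
  (brick `L`-paths), `exists_compact_preconnected_superset` (compact preconnected hull of `K ∪ {z₀}` in an
  open connected `U ⊆ ℂ`), and **`exhaustsComp_holds : ExhaustsComp`** (the linking relation on the hull is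
  locally true, symmetric, transitive ⇒ total by `IsPreconnected.induction₂'`; exhaustion of the compact
  thickening; Block 4 at the vertex next to `b + iρ/2`).
* §M.4 Assembly (sorry-free): `compA`, `FrameNoConn`, `MassRatioAtWithoutPreconnected c σ τ`,
  `finsum_comp_eq`, the converse bookkeeping `massRatioAt_of_withoutPreconnected`, with §M.6–M.8
  `massRatioAt_withoutPreconnected_of_massRatioAt`, and finally (§M.8) **`massRatioAt_withoutPreconnected_iff :
  MassRatioAtWithoutPreconnected c σ τ ↔ MassRatioAt c σ τ`** (every cut, all spins) and
  **`massRatio_iff_withoutPreconnected : MassRatio ↔ MassRatioAtWithoutPreconnected (3/4) 0 0`** —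
  THE `Preconnected` CONJUNCT OF THE CRUX IS DECORATION (theorem).
  LANDED as `Theorems/MassRatio/Negative/{Component, Decoration, HalfBall, RowsComp, KPlus, ExhaustsComp}.lean`
  (parts 22–27).
* §M.9: `massRatioAt_withoutNonempty_iff` (every cut), `massRatio_iff_withoutNonempty` — the `Nonempty`-SAW
  clause is decoration (`a_δ ≠ b_δ` eventually from the two limits + `nonempty_saw_of_preconnected`); part 28.
* §M.10: `lower_halfball_empty` — under the frame (boundary `b_δ`, inside, rows) + exhaustion + `b_δ → b`, every
  `z ∈ D ∩ B(b,ρ)` has `Im z ≥ Im b`: the lower half of the flatness clause is FORCED (consistency); part 29.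
-/

namespace Summit.CriticalPhenomena.SAWScalingLimit.Cruxes.MassRatio.Disproof

open Literature.Probability.LatticeModels Literature.Probability.RandomPlanarGeometry.SAW
open Literature.Probability.RandomPlanarGeometry
open Summit.CriticalPhenomena.SAWScalingLimit.Theses.SAWDefectDecoherence

/-! ### M.1 Components -/

/-- The `Λ`-component of `w`: the vertices of `Λ` linked to `w` inside `Λ`. [folklore] -/
noncomputable def comp (Λ : Finset HexVertex) (w : HexVertex) : Finset HexVertex := by
  classical exact Λ.filter (fun v => Linked (↑Λ : Set HexVertex) w v)

/-- Membership in the component. [folklore] -/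
theorem mem_comp {Λ : Finset HexVertex} {w v : HexVertex} :
    v ∈ comp Λ w ↔ v ∈ Λ ∧ Linked (↑Λ : Set HexVertex) w v := by
  classical
  unfold comp; rw [Finset.mem_filter]

/-- The component is a sub-domain. [folklore] -/
theorem comp_subset (Λ : Finset HexVertex) (w : HexVertex) : comp Λ w ⊆ Λ := fun _ hv =>
  (mem_comp.1 hv).1

/-- `w` lies in its component. [folklore] -/
theorem self_mem_comp {Λ : Finset HexVertex} {w : HexVertex} (hw : w ∈ Λ) : w ∈ comp Λ w :=
  mem_comp.2 ⟨hw, Linked.refl (by exact_mod_cast hw)⟩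

/-- Induction along linkage: a property of `u` that propagates along edges of `S` holds at every
vertex linked to `u`. [folklore] -/
theorem Linked.induct {S : Set HexVertex} {P : HexVertex → Prop} {u v : HexVertex}
    (h : Linked S u v) (h0 : P u)
    (hstep : ∀ x y, x ∈ S → y ∈ S → hexGraph.Adj x y → Linked S u x → P x → P y) : P v := by
  obtain ⟨hu, hv, ⟨p⟩⟩ := h
  suffices H : ∀ (s t : ↥S) (q : (hexGraph.induce S).Walk s t), Linked S u s.1 → P s.1 → P t.1 from
    H ⟨u, hu⟩ ⟨v, hv⟩ p (Linked.refl hu) h0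
  intro s t q
  induction q with
  | nil => exact fun _ hP => hP
  | @cons x y _ hadj q ih =>
    intro hl hP
    have hxy : hexGraph.Adj x.1 y.1 := by simpa [SimpleGraph.comap_adj] using hadj
    have hly : Linked S u y.1 := hl.trans (linked_of_adj x.2 y.2 hxy)
    exact ih hly (hstep x.1 y.1 x.2 y.2 hxy hl hP)

/-- Linkage inside `Λ` from `w` is linkage inside the component of `w`. [folklore] -/
theorem linked_comp {Λ : Finset HexVertex} {w v : HexVertex} (h : Linked (↑Λ : Set HexVertex) w v) :
    Linked (↑(comp Λ w) : Set HexVertex) w v := by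
  have hwΛ : w ∈ Λ := by exact_mod_cast h.mem_left
  have hw : w ∈ (↑(comp Λ w) : Set HexVertex) := by exact_mod_cast self_mem_comp hwΛ
  refine h.induct (P := fun v => Linked (↑(comp Λ w) : Set HexVertex) w v) (Linked.refl hw) ?_
  intro x y hx hy hxy hlx hPx
  have hy' : y ∈ (↑(comp Λ w) : Set HexVertex) := by
    have : y ∈ comp Λ w := mem_comp.2 ⟨by exact_mod_cast hy, hlx.trans (linked_of_adj hx hy hxy)⟩
    exact_mod_cast this
  exact hPx.trans (linked_of_adj hPx.mem_right hy' hxy)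

/-- The component is connected. [folklore] -/
theorem preconnected_comp (Λ : Finset HexVertex) (w : HexVertex) :
    (hexGraph.induce (↑(comp Λ w) : Set HexVertex)).Preconnected :=
  preconnected_of_linked fun _ hu _ hv =>
    (linked_comp (mem_comp.1 (by exact_mod_cast hu)).2).symm.trans
      (linked_comp (mem_comp.1 (by exact_mod_cast hv)).2)

/-- Along a chain of adjacent vertices of `Λ`, every vertex is linked to the first. [folklore] -/
theorem chain_linked {Λ : Finset HexVertex} :
    ∀ (l : List HexVertex) (x : HexVertex), (x :: l).IsChain hexGraph.Adj →
      (∀ v ∈ x :: l, v ∈ Λ) → ∀ v ∈ x :: l, Linked (↑Λ : Set HexVertex) x v := by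
  intro l
  induction l with
  | nil =>
    intro x _ hmem v hv
    rw [List.mem_singleton] at hv
    subst hv
    exact Linked.refl (by exact_mod_cast hmem v (by simp))
  | cons y l ih =>
    intro x hch hmem v hv
    have hxy : hexGraph.Adj x y := (List.isChain_cons_cons.1 hch).1
    have hch' : (y :: l).IsChain hexGraph.Adj := (List.isChain_cons_cons.1 hch).2
    have hx : x ∈ Λ := hmem x (by simp)
    have hy : y ∈ Λ := hmem y (by simp)
    rcases List.mem_cons.1 hv with rfl | hv
    · exact Linked.refl (by exact_mod_cast hx)
    · exact (linked_of_adj (by exact_mod_cast hx) (by exact_mod_cast hy) hxy).trans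
        (ih y hch' (fun u hu => hmem u (List.mem_cons_of_mem _ hu)) v hv)

/-- A walk from the root mid-edge `s(u, w)` (`u ∉ Λ`) visits only vertices linked to `w`. [folklore] -/
theorem verts_linked {Λ : Finset HexVertex} {u w : HexVertex} {z : Sym2 HexVertex} (hu : u ∉ Λ)
    (γ : HexMidEdgeSAW Λ s(u, w) z) : ∀ v ∈ γ.verts, Linked (↑Λ : Set HexVertex) w v := by
  intro v hv
  obtain ⟨x, l, hxl⟩ := List.exists_cons_of_ne_nil (List.ne_nil_of_mem hv)
  have hx : x ∈ s(u, w) := γ.head_mem x (by rw [hxl]; rfl)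
  have hxΛ : x ∈ Λ := γ.subset x (by rw [hxl]; simp)
  have hxw : x = w := by
    rcases Sym2.mem_iff.1 hx with rfl | rfl
    · exact absurd hxΛ hu
    · rfl
  subst hxw
  have hch : (x :: l).IsChain hexGraph.Adj := hxl ▸ γ.isChain
  exact chain_linked l x hch (fun v hv' => γ.subset v (hxl ▸ hv')) v (hxl ▸ hv)

/-- Transport of a walk from the root `s(u,w)` into the component of `w`. [folklore] -/
noncomputable def toComp {Λ : Finset HexVertex} {u w : HexVertex} {z : Sym2 HexVertex} (hu : u ∉ Λ)
    (hw : w ∈ Λ) (huw : hexGraph.Adj u w) (γ : HexMidEdgeSAW Λ s(u, w) z) :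
    HexMidEdgeSAW (comp Λ w) s(u, w) z where
  verts := γ.verts
  subset := fun v hv => mem_comp.2 ⟨γ.subset v hv, verts_linked hu γ v hv⟩
  nodup := γ.nodup
  isChain := γ.isChain
  head_mem := γ.head_mem
  getLast_mem := γ.getLast_mem
  eq_of_nil := γ.eq_of_nil
  edges_nodup := γ.edges_nodup
  fst_mem := ⟨(SimpleGraph.mem_edgeSet _).2 huw, w, Sym2.mem_mk_right _ _, self_mem_comp hw⟩

/-- Transport of a walk of a sub-domain to the big domain. [folklore] -/
def ofSubdomain {Λ Λ' : Finset HexVertex} (hsub : Λ' ⊆ Λ) {a z : Sym2 HexVertex}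
    (γ : HexMidEdgeSAW Λ' a z) : HexMidEdgeSAW Λ a z where
  verts := γ.verts
  subset := fun v hv => hsub (γ.subset v hv)
  nodup := γ.nodup
  isChain := γ.isChain
  head_mem := γ.head_mem
  getLast_mem := γ.getLast_mem
  eq_of_nil := γ.eq_of_nil
  edges_nodup := γ.edges_nodup
  fst_mem := by
    obtain ⟨he, v, hv, hvΛ⟩ := γ.fst_mem
    exact ⟨he, v, hv, hsub hvΛ⟩

/-- **The observable does not see the other components**: from the root `s(u,w)` (`u ∉ Λ`, `w ∈ Λ`),
`F_{Λ}(z) = F_{comp Λ w}(z)` for every fugacity, spin and target. [folklore] -/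
theorem observable_comp_eq {Λ : Finset HexVertex} {u w : HexVertex} (hu : u ∉ Λ) (hw : w ∈ Λ)
    (huw : hexGraph.Adj u w) (x σ : ℝ) (z : Sym2 HexVertex) :
    hexParafermionicObservable (comp Λ w) s(u, w) x σ z = hexParafermionicObservable Λ s(u, w) x σ z := by
  let e : HexMidEdgeSAW (comp Λ w) s(u, w) z ≃ HexMidEdgeSAW Λ s(u, w) z :=
    { toFun := ofSubdomain (comp_subset Λ w)
      invFun := toComp hu hw huw
      left_inv := fun γ => HexMidEdgeSAW.ext rfl
      right_inv := fun γ => HexMidEdgeSAW.ext rfl }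
  unfold hexParafermionicObservable
  exact Fintype.sum_equiv e _ _ fun γ => rfl

/-! ### M.2 Simple connectivity passes to the component -/

/-- Every vertex outside the component is linked, outside the component, to a vertex outside `Λ`
(walk right along its row until leaving the finite set `Λ`). [folklore] -/
theorem linked_compl_comp_to_compl {Λ : Finset HexVertex} {w v : HexVertex} (hv : v ∉ comp Λ w) :
    ∃ y, y ∉ Λ ∧ Linked ((↑(comp Λ w) : Set HexVertex)ᶜ) v y := by
  classical
  -- some vertex of the row of `v`, to the right, is outside `Λ`
  have hex : ∃ n : ℕ, bv (row v) (pos v + n) ∉ Λ := by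
    by_contra hall
    simp only [not_exists, not_not] at hall
    have hinj : Function.Injective (fun n : ℕ => bv (row v) (pos v + n)) := by
      intro i j hij
      have := (bv_inj hij).2
      exact_mod_cast (add_left_cancel this)
    exact (Set.infinite_of_injective_forall_mem hinj (fun n => (hall n : _ ∈ (↑Λ : Set HexVertex))))
      (Finset.finite_toSet Λ)
  let n₀ := Nat.find hex
  have hn₀ : bv (row v) (pos v + n₀) ∉ Λ := Nat.find_spec hex
  have hlt : ∀ k : ℕ, k < n₀ → bv (row v) (pos v + k) ∈ Λ := fun k hk => by
    have := Nat.find_min hex hk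
    simpa using this
  -- the run stays outside the component: a vertex of the run inside the component would drag `v` in
  have hrun : ∀ k : ℕ, k ≤ n₀ → bv (row v) (pos v + k) ∈ ((↑(comp Λ w) : Set HexVertex)ᶜ) := by
    intro k hk hk'
    have hk'' : bv (row v) (pos v + k) ∈ comp Λ w := by exact_mod_cast hk'
    rcases Nat.lt_or_ge k n₀ with hkn | hkn
    · -- linked back to `v` inside `Λ`
      have hlink : Linked (↑Λ : Set HexVertex) (bv (row v) (pos v)) (bv (row v) (pos v + k)) :=
        linked_run (row v) (pos v) k fun i hi => by exact_mod_cast hlt i (by omega)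
      rw [bv_row_pos] at hlink
      have h0 : v ∈ Λ := by
        have h0 := hlt 0 (by omega)
        rwa [show pos v + ((0 : ℕ) : ℤ) = pos v by simp, bv_row_pos] at h0
      exact hv (mem_comp.2 ⟨h0, ((mem_comp.1 hk'').2.trans hlink.symm)⟩)
    · have : k = n₀ := le_antisymm hk hkn
      subst this
      exact hn₀ (comp_subset Λ w hk'')
  refine ⟨bv (row v) (pos v + n₀), hn₀, ?_⟩
  have := linked_run (S := ((↑(comp Λ w) : Set HexVertex)ᶜ)) (row v) (pos v) n₀ hrun
  rwa [bv_row_pos] at this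

/-- **Simple connectivity passes to the component.** [folklore] -/
theorem simplyConnected_comp {Λ : Finset HexVertex} (hΛ : hexDomainSimplyConnected Λ) (w : HexVertex) :
    hexDomainSimplyConnected (comp Λ w) := by
  refine preconnected_of_linked fun x hx y hy => ?_
  have hx' : x ∉ comp Λ w := fun h => hx (by exact_mod_cast h)
  have hy' : y ∉ comp Λ w := fun h => hy (by exact_mod_cast h)
  obtain ⟨x₁, hx₁, hlx⟩ := linked_compl_comp_to_compl hx'
  obtain ⟨y₁, hy₁, hly⟩ := linked_compl_comp_to_compl hy'
  have hsub : ((↑Λ : Set HexVertex)ᶜ) ⊆ ((↑(comp Λ w) : Set HexVertex)ᶜ) :=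
    Set.compl_subset_compl.2 (by exact_mod_cast comp_subset Λ w)
  have hmid : Linked ((↑Λ : Set HexVertex)ᶜ) x₁ y₁ :=
    ⟨by exact_mod_cast hx₁, by exact_mod_cast hy₁, hΛ ⟨x₁, by exact_mod_cast hx₁⟩ ⟨y₁, by exact_mod_cast hy₁⟩⟩
  exact (hlx.trans (hmid.mono hsub)).trans hly.symm

/-! ### M.3 Boundary mid-edges and the SAW pass to the component -/

/-- The root stays a boundary mid-edge. [folklore] -/
theorem root_mem_boundary_comp {Λ : Finset HexVertex} {u w : HexVertex} (hu : u ∉ Λ) (hw : w ∈ Λ)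
    (huw : hexGraph.Adj u w) : s(u, w) ∈ hexDomainBoundary (comp Λ w) :=
  ⟨(SimpleGraph.mem_edgeSet _).2 huw, u, w, rfl, self_mem_comp hw, fun h => hu (comp_subset Λ w h)⟩

/-- A boundary target reached by a walk from the root stays a boundary mid-edge. [folklore] -/
theorem target_mem_boundary_comp {Λ : Finset HexVertex} {u w p q : HexVertex} (hu : u ∉ Λ)
    (hw : w ∈ Λ) (hp : p ∉ Λ) (hq : q ∈ Λ) (hpq : hexGraph.Adj p q)
    (γ : HexMidEdgeSAW Λ s(u, w) s(p, q)) : s(p, q) ∈ hexDomainBoundary (comp Λ w) := by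
  refine ⟨(SimpleGraph.mem_edgeSet _).2 hpq, p, q, rfl, ?_, fun h => hp (comp_subset Λ w h)⟩
  -- `q` is linked to `w`: either the walk is trivial (`{p,q} = {u,w}`, so `q = w`) or its last vertex is `q`
  by_cases hnil : γ.verts = []
  · have heq : s(u, w) = s(p, q) := γ.eq_of_nil hnil
    have hq' : q ∈ s(u, w) := by rw [heq]; exact Sym2.mem_mk_right _ _
    rcases Sym2.mem_iff.1 hq' with rfl | rfl
    · exact absurd hq hu
    · exact self_mem_comp hw
  · have hlast : γ.verts.getLast hnil ∈ s(p, q) :=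
      γ.getLast_mem _ (List.getLast?_eq_some_getLast hnil)
    have hlastΛ : γ.verts.getLast hnil ∈ Λ := γ.subset _ (List.getLast_mem hnil)
    have hlq : γ.verts.getLast hnil = q := by
      rcases Sym2.mem_iff.1 hlast with h | h
      · exact absurd (h ▸ hlastΛ) hp
      · exact h
    exact mem_comp.2 ⟨hq, hlq ▸ verts_linked hu γ _ (List.getLast_mem hnil)⟩

/-- The SAW passes to the component. [folklore] -/
theorem nonempty_saw_comp {Λ : Finset HexVertex} {u w : HexVertex} {z : Sym2 HexVertex} (hu : u ∉ Λ)
    (hw : w ∈ Λ) (huw : hexGraph.Adj u w) (h : Nonempty (HexMidEdgeSAW Λ s(u, w) z)) :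
    Nonempty (HexMidEdgeSAW (comp Λ w) s(u, w) z) :=
  ⟨toComp hu hw huw h.some⟩

/-! ## §M.4 `Preconnected` is decoration — the assembly, modulo two geometric blocks

The component of the root, as a function of the root mid-edge `a` (no endpoint chosen): `compA Λ a`.
Blocks 4 and 5 of the cycle-4 argument (the rows clause resp. exhaustion pass to the root component) are proved in
parts 25 and 27 (`rowsComp_holds`, `exhaustsComp_holds`), where the assembly is completed. -/

/-- The root component: vertices of `Λ` linked inside `Λ` to an endpoint of `a` lying in `Λ`. [folklore] -/
noncomputable def compA (Λ : Finset HexVertex) (a : Sym2 HexVertex) : Finset HexVertex := by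
  classical exact Λ.filter (fun v => ∃ w, w ∈ a ∧ w ∈ Λ ∧ Linked (↑Λ : Set HexVertex) w v)

/-- Membership in the root component. [folklore] -/
theorem mem_compA {Λ : Finset HexVertex} {a : Sym2 HexVertex} {v : HexVertex} :
    v ∈ compA Λ a ↔ v ∈ Λ ∧ ∃ w, w ∈ a ∧ w ∈ Λ ∧ Linked (↑Λ : Set HexVertex) w v := by
  classical
  unfold compA; rw [Finset.mem_filter]

/-- For a boundary root `a = s(u,w)` (`u ∉ Λ`, `w ∈ Λ`) the root component is the component of `w`. [folklore] -/
theorem compA_eq_comp {Λ : Finset HexVertex} {u w : HexVertex} (hu : u ∉ Λ) (hw : w ∈ Λ) :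
    compA Λ s(u, w) = comp Λ w := by
  ext v
  rw [mem_compA, mem_comp]
  constructor
  · rintro ⟨hv, w', hw'a, hw'Λ, hl⟩
    rcases Sym2.mem_iff.1 hw'a with rfl | rfl
    · exact absurd hw'Λ hu
    · exact ⟨hv, hl⟩
  · rintro ⟨hv, hl⟩
    exact ⟨hv, w, Sym2.mem_mk_right _ _, hw, hl⟩

/-- The frame of the crux WITHOUT the `Preconnected` conjunct. [folklore] -/
def FrameNoConn (D : DobrushinDomain) (ρ : ℝ) (Λ : ℝ → Finset HexVertex) (m : ℝ → ℤ)
    (a b : ℝ → Sym2 HexVertex) : Prop :=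
  ∀ᶠ δ : ℝ in nhdsWithin 0 (Set.Ioi 0), hexDomainSimplyConnected (Λ δ) ∧
    a δ ∈ hexDomainBoundary (Λ δ) ∧ b δ ∈ hexDomainBoundary (Λ δ) ∧
    Nonempty (HexMidEdgeSAW (Λ δ) (a δ) (b δ)) ∧
    (∀ v ∈ Λ δ, (δ : ℂ) * hexCenter v ∈ D.carrier) ∧
    (∀ v : HexVertex, (δ : ℂ) * hexCenter v ∈ Metric.ball (D.pt 1) ρ → (v ∈ Λ δ ↔ m δ ≤ v.1 1))

/-- The crux at cut `c` with the `Preconnected` conjunct deleted (a strengthening). [folklore] -/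
def MassRatioAtWithoutPreconnected (c σ τ : ℝ) : Prop :=
  ∀ (D : DobrushinDomain) (ρ : ℝ) (Λ : ℝ → Finset HexVertex) (m : ℝ → ℤ) (a b : ℝ → Sym2 HexVertex),
    0 < ρ → Flat D ρ → FrameNoConn D ρ Λ m a b → Exhausts D Λ → ALim D a → BLim D b →
      Conclusion c σ τ D Λ a b

/-- No walk from `a` ends on a pair `z ≠ a` none of whose members lies in the domain: the observable
vanishes there. [folklore] -/
theorem observable_eq_zero_of_forall_not_mem {Λ : Finset HexVertex} {a z : Sym2 HexVertex}
    (hz : ∀ v ∈ z, v ∉ Λ) (haz : a ≠ z) (x σ : ℝ) :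
    hexParafermionicObservable Λ a x σ z = 0 := by
  have hempty : IsEmpty (HexMidEdgeSAW Λ a z) := by
    refine ⟨fun γ => ?_⟩
    by_cases hnil : γ.verts = []
    · exact haz (γ.eq_of_nil hnil)
    · exact hz _ (γ.getLast_mem _ (List.getLast?_eq_some_getLast hnil)) (γ.subset _ (List.getLast_mem hnil))
  unfold hexParafermionicObservable
  exact Fintype.sum_empty _

/-- The `K`-restricted `L¹` mass of `F_σ` is the same on `Λ` and on the component of the root. [folklore] -/
theorem finsum_comp_eq {Λ : Finset HexVertex} {u w : HexVertex} (hu : u ∉ Λ) (hw : w ∈ Λ)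
    (huw : hexGraph.Adj u w) (x σ : ℝ) (P : Sym2 HexVertex → Prop) :
    (∑ᶠ e ∈ {e : Sym2 HexVertex | e ∈ hexDomainMidEdges (comp Λ w) ∧ P e},
        ‖hexParafermionicObservable (comp Λ w) s(u, w) x σ e‖) =
      ∑ᶠ e ∈ {e : Sym2 HexVertex | e ∈ hexDomainMidEdges Λ ∧ P e},
        ‖hexParafermionicObservable Λ s(u, w) x σ e‖ := by
  set f : Sym2 HexVertex → ℝ := fun e => ‖hexParafermionicObservable Λ s(u, w) x σ e‖ with hf
  have step1 : (∑ᶠ e ∈ {e : Sym2 HexVertex | e ∈ hexDomainMidEdges (comp Λ w) ∧ P e},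
      ‖hexParafermionicObservable (comp Λ w) s(u, w) x σ e‖) =
      ∑ᶠ e ∈ {e : Sym2 HexVertex | e ∈ hexDomainMidEdges (comp Λ w) ∧ P e}, f e :=
    finsum_mem_congr rfl fun e _ => by simp only [hf, observable_comp_eq hu hw huw]
  have hset : {e : Sym2 HexVertex | e ∈ hexDomainMidEdges (comp Λ w) ∧ P e} ∩ Function.support f =
      {e : Sym2 HexVertex | e ∈ hexDomainMidEdges Λ ∧ P e} ∩ Function.support f := by
    ext e
    simp only [Set.mem_inter_iff, Set.mem_setOf_eq, Function.mem_support]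
    constructor
    · rintro ⟨⟨⟨he, v, hv, hvc⟩, hP⟩, hne⟩
      exact ⟨⟨⟨he, v, hv, comp_subset Λ w hvc⟩, hP⟩, hne⟩
    · rintro ⟨⟨⟨he, v, hv, hvΛ⟩, hP⟩, hne⟩
      refine ⟨⟨⟨he, ?_⟩, hP⟩, hne⟩
      by_contra hnone
      simp only [not_exists, not_and] at hnone
      apply hne
      have haz : s(u, w) ≠ e := by
        intro hae; subst hae
        exact hnone w (Sym2.mem_mk_right _ _) (self_mem_comp hw)
      show ‖hexParafermionicObservable Λ s(u, w) x σ e‖ = 0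
      rw [← observable_comp_eq hu hw huw, observable_eq_zero_of_forall_not_mem (fun v hv' hvc => hnone v hv' hvc) haz,
        norm_zero]
  rw [step1, ← finsum_mem_inter_support f {e : Sym2 HexVertex | e ∈ hexDomainMidEdges (comp Λ w) ∧ P e}, hset,
    finsum_mem_inter_support]

/-- The converse bookkeeping: the `Preconnected`-free statement is a strengthening. [folklore] -/
theorem massRatioAt_of_withoutPreconnected {c σ τ : ℝ} (h : MassRatioAtWithoutPreconnected c σ τ) :
    MassRatioAt c σ τ := fun D ρ Λ m a b hρ hflat hfr hex ha hb =>
  h D ρ Λ m a b hρ hflat (hfr.mono fun _ hδ =>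
    ⟨hδ.1, hδ.2.1, hδ.2.2.1, hδ.2.2.2.1, hδ.2.2.2.2.2.1, hδ.2.2.2.2.2.2⟩) hex ha hb

/-! ### M.5 Linkage of the discrete half-ball `{row ≥ m} ∩ B(c, ρ)` (Block 4, geometric core) -/

/-- Ball membership as a quadratic inequality in the coordinates. [folklore] -/
theorem mem_ball_iff_sq {z c : ℂ} {ρ : ℝ} (hρ : 0 < ρ) :
    z ∈ Metric.ball c ρ ↔ (z.re - c.re) ^ 2 + (z.im - c.im) ^ 2 < ρ ^ 2 := by
  rw [Metric.mem_ball, Complex.dist_eq]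
  have h1 : ‖z - c‖ ^ 2 = (z.re - c.re) ^ 2 + (z.im - c.im) ^ 2 := by
    rw [Complex.sq_norm, Complex.normSq_apply, Complex.sub_re, Complex.sub_im]; ring
  rw [← h1]
  exact (pow_lt_pow_iff_left₀ (norm_nonneg _) hρ.le two_ne_zero).symm

/-- Scaled real part of a brick vertex. [folklore] -/
theorem re_bv_scaled (δ : ℝ) (r p : ℤ) : ((δ : ℂ) * hexCenter (bv r p)).re = δ * ((p : ℝ) + 1) / 2 := by
  rw [re_scaled, pos_bv]

/-- Scaled imaginary part of a low-type (even) brick vertex. [folklore] -/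
theorem im_bv_scaled_even (δ : ℝ) {r p : ℤ} (h : (p - r) % 2 = 0) :
    ((δ : ℂ) * hexCenter (bv r p)).im = δ * hgt * ((r : ℝ) + 1 / 3) := by
  rw [im_scaled, im_center_bv_even h]; ring

/-- Scaled imaginary part of a high-type (odd) brick vertex. [folklore] -/
theorem im_bv_scaled_odd (δ : ℝ) {r p : ℤ} (h : (p - r) % 2 = 1) :
    ((δ : ℂ) * hexCenter (bv r p)).im = δ * hgt * ((r : ℝ) + 2 / 3) := by
  rw [im_scaled, im_center_bv_odd h]; ring

/-- Monotone step inside a ball: shrinking `|X|` and `Y ≥ 0` keeps a point inside. [folklore] -/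
theorem sq_step {X Y X' Y' ρ : ℝ} (hball : X ^ 2 + Y ^ 2 < ρ ^ 2) (hX : |X'| ≤ |X|) (hY0 : 0 ≤ Y')
    (hY : Y' ≤ Y) : X' ^ 2 + Y' ^ 2 < ρ ^ 2 := by
  have h1 : X' ^ 2 ≤ X ^ 2 := by
    rw [← sq_abs X', ← sq_abs X]; exact pow_le_pow_left₀ (abs_nonneg _) hX 2
  have h2 : Y' ^ 2 ≤ Y ^ 2 := pow_le_pow_left₀ hY0 hY 2
  linarith

section HalfBall

variable {δ ρ : ℝ} {c : ℂ} {m : ℤ} {S : Set HexVertex}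

/-- the float height of the low row-`m` vertices above the centre line -/
local notation "η" => δ * hgt * ((m : ℝ) + 1 / 3) - c.im

/-- ball membership of a brick vertex, even parity, in coordinates -/
theorem inBall_even (hρ : 0 < ρ) {r p : ℤ} (h : (p - r) % 2 = 0) :
    (δ : ℂ) * hexCenter (bv r p) ∈ Metric.ball c ρ ↔
      (δ * ((p : ℝ) + 1) / 2 - c.re) ^ 2 + (δ * hgt * ((r : ℝ) + 1 / 3) - c.im) ^ 2 < ρ ^ 2 := by
  rw [mem_ball_iff_sq hρ, re_bv_scaled, im_bv_scaled_even δ h]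

/-- ball membership of a brick vertex, odd parity, in coordinates -/
theorem inBall_odd (hρ : 0 < ρ) {r p : ℤ} (h : (p - r) % 2 = 1) :
    (δ : ℂ) * hexCenter (bv r p) ∈ Metric.ball c ρ ↔
      (δ * ((p : ℝ) + 1) / 2 - c.re) ^ 2 + (δ * hgt * ((r : ℝ) + 2 / 3) - c.im) ^ 2 < ρ ^ 2 := by
  rw [mem_ball_iff_sq hρ, re_bv_scaled, im_bv_scaled_odd δ h]

variable (hδ : 0 < δ) (hρ : 0 < ρ) (hδρ : 10 * δ ≤ ρ)
  (hS : ∀ v : HexVertex, (δ : ℂ) * hexCenter v ∈ Metric.ball c ρ → m ≤ row v → v ∈ S)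
  (hη0 : c.im < δ * hgt * ((m : ℝ) + 1 / 3)) (hη1 : δ * hgt * ((m : ℝ) + 1 / 3) ≤ c.im + ρ / 2)

/-- the central position of row `m` -/
noncomputable def p₀ (δ : ℝ) (c : ℂ) : ℤ := ⌊2 * c.re / δ⌋ - 1

include hδ in
theorem abs_X_p₀ : |δ * (((p₀ δ c : ℤ) : ℝ) + 1) / 2 - c.re| ≤ δ / 2 := by
  have h1 := Int.floor_le (2 * c.re / δ)
  have h2 := Int.lt_floor_add_one (2 * c.re / δ)
  have hp : ((p₀ δ c : ℤ) : ℝ) + 1 = (⌊2 * c.re / δ⌋ : ℝ) := by simp [p₀]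
  rw [hp, abs_le]
  constructor
  · have : δ * ((⌊2 * c.re / δ⌋ : ℝ)) ≥ δ * (2 * c.re / δ - 1) := by
      apply mul_le_mul_of_nonneg_left _ hδ.le; linarith
    have e : δ * (2 * c.re / δ - 1) = 2 * c.re - δ := by field_simp
    linarith
  · have : δ * ((⌊2 * c.re / δ⌋ : ℝ)) ≤ δ * (2 * c.re / δ) := mul_le_mul_of_nonneg_left h1 hδ.le
    have e : δ * (2 * c.re / δ) = 2 * c.re := by field_simp
    linarith

include hδ hρ hδρ hη0 hη1 in
/-- Every row-`m` vertex of the central window `|X| ≤ η + 2δ` lies in the ball. [folklore] -/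
theorem inBall_window {t : ℤ} (ht : |δ * ((t : ℝ) + 1) / 2 - c.re| ≤ η + 2 * δ) :
    (δ : ℂ) * hexCenter (bv m t) ∈ Metric.ball c ρ := by
  have hg1 := hgt_gt
  have hg2 := hgt_lt
  have hA0 : 0 ≤ η + 2 * δ := by linarith
  have hA : η + 2 * δ ≤ 7 / 10 * ρ := by linarith
  have hX2 : (δ * ((t : ℝ) + 1) / 2 - c.re) ^ 2 ≤ (7 / 10 * ρ) ^ 2 := by
    rw [← sq_abs]; exact pow_le_pow_left₀ (abs_nonneg _) (ht.trans hA) 2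
  have hdh : δ * hgt / 3 ≤ ρ / 30 := by nlinarith
  rcases Int.emod_two_eq_zero_or_one (t - m) with h | h
  · rw [inBall_even hρ h]
    have hB0 : 0 ≤ η := by linarith
    have hB : η ≤ 6 / 10 * ρ := by linarith
    have hB2 : η ^ 2 ≤ (6 / 10 * ρ) ^ 2 := pow_le_pow_left₀ hB0 hB 2
    nlinarith
  · rw [inBall_odd hρ h]
    have e : (δ * hgt * ((m : ℝ) + 2 / 3) - c.im) = η + δ * hgt / 3 := by ring
    rw [e]
    have hB0 : 0 ≤ η + δ * hgt / 3 := by nlinarith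
    have hB : η + δ * hgt / 3 ≤ 6 / 10 * ρ := by linarith
    have hB2 : (η + δ * hgt / 3) ^ 2 ≤ (6 / 10 * ρ) ^ 2 := pow_le_pow_left₀ hB0 hB 2
    nlinarith

include hδ hη0 in
/-- Row-`m` inward step `low → high` stays in the ball. [folklore] -/
theorem step_in_low {X R : ℝ} (hp : X ^ 2 + η ^ 2 < R ^ 2) (hW : η + 2 * δ < X) :
    (X - δ / 2) ^ 2 + (η + δ * hgt / 3) ^ 2 < R ^ 2 := by
  have hg1 := hgt_gt
  have hg2 := hgt_lt
  have hη : 0 < η := by linarith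
  have hXd : δ * (η + 2 * δ) < δ * X := mul_lt_mul_of_pos_left hW hδ
  have h3 : δ * hgt * η ≤ δ * η := by nlinarith [mul_pos hδ hη]
  have hh : hgt ^ 2 ≤ 1 := by nlinarith
  have h4 : δ ^ 2 * hgt ^ 2 ≤ δ ^ 2 := by
    calc δ ^ 2 * hgt ^ 2 ≤ δ ^ 2 * 1 := mul_le_mul_of_nonneg_left hh (sq_nonneg δ)
      _ = δ ^ 2 := mul_one _
  nlinarith

include hδ hη0 in
/-- Row-`m` inward step `high → low` stays in the ball. [folklore] -/
theorem step_in_high {X R : ℝ} (hp : X ^ 2 + (η + δ * hgt / 3) ^ 2 < R ^ 2) (hW : η + 2 * δ < X) :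
    (X - δ / 2) ^ 2 + η ^ 2 < R ^ 2 := by
  have hg1 := hgt_gt
  have hη : 0 < η := by linarith
  have hXd : δ * (η + 2 * δ) < δ * X := mul_lt_mul_of_pos_left hW hδ
  have h5 : η ^ 2 ≤ (η + δ * hgt / 3) ^ 2 :=
    pow_le_pow_left₀ hη.le (by nlinarith) 2
  nlinarith

include hδ hρ hδρ hS hη0 hη1 in
/-- Row `m`: every vertex of the ball is linked inside `S` to the central vertex `bv m p₀`. [folklore] -/
theorem linked_rowm {p : ℤ} (hp : (δ : ℂ) * hexCenter (bv m p) ∈ Metric.ball c ρ) :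
    Linked S (bv m p) (bv m (p₀ δ c)) := by
  have hg1 := hgt_gt
  have hg2 := hgt_lt
  have hP0 := abs_X_p₀ (c := c) hδ
  -- the window run: if `|X(p)| ≤ η + 2δ` then the whole run between `p` and `p₀` is in the window
  have window : ∀ p : ℤ, |δ * ((p : ℝ) + 1) / 2 - c.re| ≤ η + 2 * δ →
      Linked S (bv m p) (bv m (p₀ δ c)) := by
    intro p hpW
    have hmem : ∀ t : ℤ, min p (p₀ δ c) ≤ t → t ≤ max p (p₀ δ c) → bv m t ∈ S := by
      intro t ht1 ht2
      refine hS _ (inBall_window hδ hρ hδρ hη0 hη1 ?_) (by rw [row_bv])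
      rw [abs_le] at hpW hP0 ⊢
      have hlo : -(η + 2 * δ) ≤ δ * (((min p (p₀ δ c) : ℤ) : ℝ) + 1) / 2 - c.re := by
        rcases le_total p (p₀ δ c) with hle | hle
        · rw [min_eq_left hle]; linarith
        · rw [min_eq_right hle]; linarith
      have hhi : δ * (((max p (p₀ δ c) : ℤ) : ℝ) + 1) / 2 - c.re ≤ η + 2 * δ := by
        rcases le_total p (p₀ δ c) with hle | hle
        · rw [max_eq_right hle]; linarith
        · rw [max_eq_left hle]; linarith
      have h1 : ((min p (p₀ δ c) : ℤ) : ℝ) ≤ t := by exact_mod_cast ht1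
      have h2 : (t : ℝ) ≤ ((max p (p₀ δ c) : ℤ) : ℝ) := by exact_mod_cast ht2
      constructor <;> nlinarith
    rcases le_total p (p₀ δ c) with hle | hle
    · exact linked_run' m p (p₀ δ c) hle fun t h1 h2 => hmem t (by rw [min_eq_left hle]; exact h1)
        (by rw [max_eq_right hle]; exact h2)
    · exact (linked_run' m (p₀ δ c) p hle fun t h1 h2 => hmem t (by rw [min_eq_right hle]; exact h1)
        (by rw [max_eq_left hle]; exact h2)).symm
  -- outside the window: step towards the centre; induction on the distance to `p₀`
  suffices H : ∀ n : ℕ, ∀ p : ℤ, (p - p₀ δ c).natAbs ≤ n →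
      (δ : ℂ) * hexCenter (bv m p) ∈ Metric.ball c ρ → Linked S (bv m p) (bv m (p₀ δ c)) from
    H _ p le_rfl hp
  intro n
  induction n with
  | zero =>
    intro p hn hp
    have : p = p₀ δ c := by omega
    subst this
    exact Linked.refl (hS _ hp (by rw [row_bv]))
  | succ n ih =>
    intro p hn hp
    by_cases hW : |δ * ((p : ℝ) + 1) / 2 - c.re| ≤ η + 2 * δ
    · exact window p hW
    · rw [not_le] at hW
      have hpS : bv m p ∈ S := hS _ hp (by rw [row_bv])
      -- the sign of `X(p)` decides the direction
      rcases le_or_gt 0 (δ * ((p : ℝ) + 1) / 2 - c.re) with hpos | hneg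
      · -- `X(p) > η + 2δ > 0`: step to `p - 1`
        rw [abs_of_nonneg hpos] at hW
        have hgt0 : p₀ δ c < p := by
          by_contra hle
          have : (p : ℝ) ≤ p₀ δ c := by exact_mod_cast not_lt.1 hle
          rw [abs_le] at hP0
          nlinarith
        have hball' : (δ : ℂ) * hexCenter (bv m (p - 1)) ∈ Metric.ball c ρ := by
          have e1 : δ * (((p - 1 : ℤ) : ℝ) + 1) / 2 - c.re = (δ * ((p : ℝ) + 1) / 2 - c.re) - δ / 2 := by
            push_cast; ring
          have e2 : δ * hgt * ((m : ℝ) + 2 / 3) - c.im = η + δ * hgt / 3 := by ring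
          rcases Int.emod_two_eq_zero_or_one (p - m) with h | h
          · -- `p` low, `p - 1` high
            have h' : (p - 1 - m) % 2 = 1 := by omega
            rw [inBall_even hρ h] at hp
            rw [inBall_odd hρ h', e1, e2]
            exact step_in_low hδ hη0 hp hW
          · -- `p` high, `p - 1` low
            have h' : (p - 1 - m) % 2 = 0 := by omega
            rw [inBall_odd hρ h, e2] at hp
            rw [inBall_even hρ h', e1]
            exact step_in_high hδ hη0 hp hW
        have hlink := ih (p - 1) (by omega) hball'
        have hadj : hexGraph.Adj (bv m p) (bv m (p - 1)) := by
          rw [adj_bv_iff]; left; exact ⟨rfl, Or.inr rfl⟩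
        exact (linked_of_adj hpS (hS _ hball' (by rw [row_bv])) hadj).trans hlink
      · -- `X(p) < -(η + 2δ) < 0`: step to `p + 1`
        rw [abs_of_neg hneg] at hW
        have hlt0 : p < p₀ δ c := by
          by_contra hle
          have : (p₀ δ c : ℝ) ≤ p := by exact_mod_cast not_lt.1 hle
          rw [abs_le] at hP0
          nlinarith
        have hball' : (δ : ℂ) * hexCenter (bv m (p + 1)) ∈ Metric.ball c ρ := by
          -- reflect: `X ↦ -X`
          have e1 : δ * (((p + 1 : ℤ) : ℝ) + 1) / 2 - c.re = -((-(δ * ((p : ℝ) + 1) / 2 - c.re)) - δ / 2) := by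
            push_cast; ring
          have e2 : δ * hgt * ((m : ℝ) + 2 / 3) - c.im = η + δ * hgt / 3 := by ring
          have hp' : (-(δ * ((p : ℝ) + 1) / 2 - c.re)) ^ 2 = (δ * ((p : ℝ) + 1) / 2 - c.re) ^ 2 := by ring
          rcases Int.emod_two_eq_zero_or_one (p - m) with h | h
          · have h' : (p + 1 - m) % 2 = 1 := by omega
            rw [inBall_even hρ h, ← hp'] at hp
            rw [inBall_odd hρ h', e1, e2, neg_sq]
            exact step_in_low hδ hη0 hp hW
          · have h' : (p + 1 - m) % 2 = 0 := by omega
            rw [inBall_odd hρ h, e2, ← hp'] at hp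
            rw [inBall_even hρ h', e1, neg_sq]
            exact step_in_high hδ hη0 hp hW
        have hlink := ih (p + 1) (by omega) hball'
        have hadj : hexGraph.Adj (bv m p) (bv m (p + 1)) := by
          rw [adj_bv_iff]; left; exact ⟨rfl, Or.inl rfl⟩
        exact (linked_of_adj hpS (hS _ hball' (by rw [row_bv])) hadj).trans hlink

include hδ hρ hδρ in
/-- Horizontal inward step from a high-type vertex (any row `≥ m`) stays in the ball. [folklore] -/
theorem step_horiz {X Y : ℝ} (hp : X ^ 2 + (Y + δ * hgt / 3) ^ 2 < ρ ^ 2) (hX : 0 ≤ X) (hY : 0 ≤ Y) :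
    (X - δ / 2) ^ 2 + Y ^ 2 < ρ ^ 2 := by
  have hg1 := hgt_gt
  have hg2 := hgt_lt
  have hdh : 0 ≤ δ * hgt / 3 := by nlinarith
  rcases le_or_gt (δ / 2) X with hc | hc
  · refine sq_step hp ?_ hY (by linarith)
    rw [abs_of_nonneg (by linarith), abs_of_nonneg hX]; linarith
  · have h1 : (X - δ / 2) ^ 2 ≤ (δ / 2) ^ 2 := by
      rw [← sq_abs (X - δ / 2)]
      refine pow_le_pow_left₀ (abs_nonneg _) ?_ 2
      rw [abs_le]; constructor <;> linarith
    have h2 : Y + δ * hgt / 3 < ρ := by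
      have hsq : (Y + δ * hgt / 3) ^ 2 < ρ ^ 2 := by nlinarith [sq_nonneg X]
      have := abs_lt_of_sq_lt_sq hsq hρ.le
      exact (abs_lt.1 this).2
    have h3 : Y ^ 2 < (ρ - δ * hgt / 3) ^ 2 := by
      have hlt : Y < ρ - δ * hgt / 3 := by linarith
      nlinarith [mul_pos (sub_pos.2 hlt) (show 0 < ρ - δ * hgt / 3 + Y by linarith)]
    nlinarith [mul_pos hδ hρ]

include hδ hρ hδρ hS hη0 hη1 in
/-- **Linkage of the discrete half-ball, by rows**: every vertex `bv (m+n) p` of the ball is linked inside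
`S` to the central row-`m` vertex `bv m p₀`. [folklore] -/
theorem linked_halfball : ∀ (n : ℕ) (r p : ℤ), r = m + n →
    (δ : ℂ) * hexCenter (bv r p) ∈ Metric.ball c ρ → Linked S (bv r p) (bv m (p₀ δ c)) := by
  intro n
  induction n with
  | zero =>
    intro r p hr hp
    have : r = m := by rw [hr]; simp
    subst this
    exact linked_rowm hδ hρ hδρ hS hη0 hη1 hp
  | succ n ih =>
    intro r p hr hp
    have hg1 := hgt_gt
    have hhgt : (0 : ℝ) < hgt := by linarith
    have hrm : m + 1 ≤ r := by omega
    have hrR : (r : ℝ) = m + n + 1 := by rw [hr]; push_cast; ring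
    -- the low (even) case, reused by the high case
    have low_case : ∀ p : ℤ, (p - r) % 2 = 0 → (δ : ℂ) * hexCenter (bv r p) ∈ Metric.ball c ρ →
        Linked S (bv r p) (bv m (p₀ δ c)) := by
      intro p h hp
      have h' : (p - (r - 1)) % 2 = 1 := by omega
      have hball' : (δ : ℂ) * hexCenter (bv (r - 1) p) ∈ Metric.ball c ρ := by
        rw [inBall_even hρ h] at hp
        rw [inBall_odd hρ h']
        have e : δ * hgt * (((r - 1 : ℤ) : ℝ) + 2 / 3) - c.im =
            (δ * hgt * ((r : ℝ) + 1 / 3) - c.im) - 2 * (δ * hgt) / 3 := by push_cast; ring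
        rw [e]
        refine sq_step hp le_rfl ?_ ?_
        · rw [hrR]
          have hn0 : (0 : ℝ) ≤ n := by positivity
          nlinarith [mul_pos hδ hhgt, mul_nonneg (mul_pos hδ hhgt).le hn0]
        · nlinarith [mul_pos hδ hhgt]
      have hlink := ih (r - 1) p (by omega) hball'
      have hadj : hexGraph.Adj (bv r p) (bv (r - 1) p) := by
        rw [adj_bv_iff]; right; left; exact ⟨rfl, rfl, h⟩
      exact (linked_of_adj (hS _ hp (by rw [row_bv]; omega)) (hS _ hball' (by rw [row_bv]; omega))
        hadj).trans hlink
    rcases Int.emod_two_eq_zero_or_one (p - r) with h | h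
    · exact low_case p h hp
    · -- high vertex: horizontal step towards the centre lands on a low vertex of the same row
      have hYe : δ * hgt * ((r : ℝ) + 2 / 3) - c.im = (δ * hgt * ((r : ℝ) + 1 / 3) - c.im) + δ * hgt / 3 := by
        ring
      have hY0 : 0 ≤ δ * hgt * ((r : ℝ) + 1 / 3) - c.im := by
        rw [hrR]
        have hn0 : (0 : ℝ) ≤ n := by positivity
        nlinarith [mul_pos hδ hhgt, mul_nonneg (mul_pos hδ hhgt).le hn0]
      have hpS : bv r p ∈ S := hS _ hp (by rw [row_bv]; omega)
      rw [inBall_odd hρ h, hYe] at hp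
      rcases le_or_gt 0 (δ * ((p : ℝ) + 1) / 2 - c.re) with hpos | hneg
      · have h' : (p - 1 - r) % 2 = 0 := by omega
        have hball' : (δ : ℂ) * hexCenter (bv r (p - 1)) ∈ Metric.ball c ρ := by
          rw [inBall_even hρ h']
          have e1 : δ * (((p - 1 : ℤ) : ℝ) + 1) / 2 - c.re = (δ * ((p : ℝ) + 1) / 2 - c.re) - δ / 2 := by
            push_cast; ring
          rw [e1]
          exact step_horiz hδ hρ hδρ hp hpos hY0
        have hadj : hexGraph.Adj (bv r p) (bv r (p - 1)) := by
          rw [adj_bv_iff]; left; exact ⟨rfl, Or.inr rfl⟩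
        exact (linked_of_adj hpS (hS _ hball' (by rw [row_bv]; omega)) hadj).trans (low_case _ h' hball')
      · have h' : (p + 1 - r) % 2 = 0 := by omega
        have hball' : (δ : ℂ) * hexCenter (bv r (p + 1)) ∈ Metric.ball c ρ := by
          rw [inBall_even hρ h']
          have e1 : δ * (((p + 1 : ℤ) : ℝ) + 1) / 2 - c.re = -((-(δ * ((p : ℝ) + 1) / 2 - c.re)) - δ / 2) := by
            push_cast; ring
          have hp' : (-(δ * ((p : ℝ) + 1) / 2 - c.re)) ^ 2 + (δ * hgt * ((r : ℝ) + 1 / 3) - c.im + δ * hgt / 3) ^ 2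
              < ρ ^ 2 := by rwa [neg_sq]
          rw [e1, neg_sq]
          exact step_horiz hδ hρ hδρ hp' (by linarith) hY0
        have hadj : hexGraph.Adj (bv r p) (bv r (p + 1)) := by
          rw [adj_bv_iff]; left; exact ⟨rfl, Or.inl rfl⟩
        exact (linked_of_adj hpS (hS _ hball' (by rw [row_bv]; omega)) hadj).trans (low_case _ h' hball')

include hδ hρ hδρ hS hη0 hη1 in
/-- **Linkage of the discrete half-ball**: every vertex `v` with `δ c_v ∈ B(c, ρ)` and `row v ≥ m` is linked
inside `S` to the central row-`m` vertex — provided `10 δ ≤ ρ`, the low row-`m` height is above `Im c` and at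
most `ρ/2` above it, and `S` contains all such vertices (the rows clause). [folklore] -/
theorem halfball_linked {v : HexVertex} (hv : (δ : ℂ) * hexCenter v ∈ Metric.ball c ρ) (hvm : m ≤ row v) :
    Linked S v (bv m (p₀ δ c)) := by
  obtain ⟨n, hn⟩ : ∃ n : ℕ, row v = m + n := ⟨(row v - m).toNat, by omega⟩
  have h := linked_halfball hδ hρ hδρ hS hη0 hη1 n (row v) (pos v) hn (by rwa [bv_row_pos])
  rwa [bv_row_pos] at h

end HalfBall

/-! ### M.6 Block 4 discharged: the rows clause passes to the root component (`rowsComp_holds`) -/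

/-- The type bit of a vertex is the parity of `pos - row`. [folklore] -/
theorem snd_eq_parity (v : HexVertex) : ((v.2 : ℕ) : ℤ) = (pos v - row v) % 2 := by
  have hk : (v.2 : ℕ) < 2 := v.2.isLt
  unfold pos row
  omega

/-- Adjacent centres are at distance `≤ 1` (in fact `1/√3`; coordinates). [folklore] -/
theorem norm_center_sub_le_one {v t : HexVertex} (h : hexGraph.Adj v t) :
    ‖hexCenter v - hexCenter t‖ ≤ 1 := by
  have hsq : ‖hexCenter v - hexCenter t‖ ^ 2 =
      ((hexCenter v).re - (hexCenter t).re) ^ 2 + ((hexCenter v).im - (hexCenter t).im) ^ 2 := by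
    rw [Complex.sq_norm, Complex.normSq_apply, Complex.sub_re, Complex.sub_im]; ring
  have hs : (Real.sqrt 3) ^ 2 = 3 := Real.sq_sqrt (by norm_num)
  have hkv : (v.2 : ℕ) ≤ 1 := by have := v.2.isLt; omega
  have hkt : (t.2 : ℕ) ≤ 1 := by have := t.2.isLt; omega
  have hpv := snd_eq_parity v
  have hpt := snd_eq_parity t
  have hle : ‖hexCenter v - hexCenter t‖ ^ 2 ≤ 1 := by
    rw [hsq, hexCenter_re, hexCenter_re, hexCenter_im, hexCenter_im]
    rcases (adj_iff v t).1 h with ⟨hr, hp⟩ | ⟨hp, hr, hpar⟩ | ⟨hp, hr, hpar⟩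
    · have hr' : (row t : ℝ) = row v := by exact_mod_cast hr.symm
      have hkk : ((((v.2 : ℕ) : ℝ)) - ((t.2 : ℕ) : ℝ)) ^ 2 ≤ 1 := by
        have h1 : (((v.2 : ℕ) : ℝ)) ≤ 1 := by exact_mod_cast hkv
        have h2 : (((t.2 : ℕ) : ℝ)) ≤ 1 := by exact_mod_cast hkt
        have h3 : (0 : ℝ) ≤ ((v.2 : ℕ) : ℝ) := by positivity
        have h4 : (0 : ℝ) ≤ ((t.2 : ℕ) : ℝ) := by positivity
        rw [sq_le_one_iff_abs_le_one, abs_le]; constructor <;> linarith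
      rcases hp with hp | hp
      · have hp' : (pos t : ℝ) = pos v + 1 := by exact_mod_cast hp
        rw [hr', hp']
        have e : (((pos v : ℝ) + 1) / 2 - ((pos v : ℝ) + 1 + 1) / 2) ^ 2 +
            (Real.sqrt 3 / 2 * ((row v : ℝ) + ((((v.2 : ℕ) : ℝ)) + 1) / 3) -
              Real.sqrt 3 / 2 * ((row v : ℝ) + ((((t.2 : ℕ) : ℝ)) + 1) / 3)) ^ 2 =
            1 / 4 + (Real.sqrt 3) ^ 2 * ((((v.2 : ℕ) : ℝ)) - ((t.2 : ℕ) : ℝ)) ^ 2 / 36 := by ring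
        rw [e, hs]; linarith
      · have hp' : (pos t : ℝ) = pos v - 1 := by exact_mod_cast hp
        rw [hr', hp']
        have e : (((pos v : ℝ) + 1) / 2 - ((pos v : ℝ) - 1 + 1) / 2) ^ 2 +
            (Real.sqrt 3 / 2 * ((row v : ℝ) + ((((v.2 : ℕ) : ℝ)) + 1) / 3) -
              Real.sqrt 3 / 2 * ((row v : ℝ) + ((((t.2 : ℕ) : ℝ)) + 1) / 3)) ^ 2 =
            1 / 4 + (Real.sqrt 3) ^ 2 * ((((v.2 : ℕ) : ℝ)) - ((t.2 : ℕ) : ℝ)) ^ 2 / 36 := by ring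
        rw [e, hs]; linarith
    · -- `t` below `v`: `v` low (`k = 0`), `t` high (`k = 1`)
      have hkv0 : (v.2 : ℕ) = 0 := by omega
      have hkt1 : (t.2 : ℕ) = 1 := by omega
      have hp' : (pos t : ℝ) = pos v := by exact_mod_cast hp.symm
      have hr' : (row t : ℝ) = row v - 1 := by exact_mod_cast hr
      rw [hr', hp', hkv0, hkt1]
      have e : (((pos v : ℝ) + 1) / 2 - ((pos v : ℝ) + 1) / 2) ^ 2 +
          (Real.sqrt 3 / 2 * ((row v : ℝ) + (((0 : ℕ) : ℝ) + 1) / 3) -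
            Real.sqrt 3 / 2 * ((row v : ℝ) - 1 + (((1 : ℕ) : ℝ) + 1) / 3)) ^ 2 = (Real.sqrt 3) ^ 2 / 9 := by
        push_cast; ring
      rw [e, hs]; norm_num
    · -- `t` above `v`: `v` high (`k = 1`), `t` low (`k = 0`)
      have hkv1 : (v.2 : ℕ) = 1 := by omega
      have hkt0 : (t.2 : ℕ) = 0 := by omega
      have hp' : (pos t : ℝ) = pos v := by exact_mod_cast hp.symm
      have hr' : (row t : ℝ) = row v + 1 := by exact_mod_cast hr
      rw [hr', hp', hkv1, hkt0]
      have e : (((pos v : ℝ) + 1) / 2 - ((pos v : ℝ) + 1) / 2) ^ 2 +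
          (Real.sqrt 3 / 2 * ((row v : ℝ) + (((1 : ℕ) : ℝ) + 1) / 3) -
            Real.sqrt 3 / 2 * ((row v : ℝ) + 1 + (((0 : ℕ) : ℝ) + 1) / 3)) ^ 2 = (Real.sqrt 3) ^ 2 / 9 := by
        push_cast; ring
      rw [e, hs]; norm_num
  exact (sq_le_one_iff₀ (norm_nonneg _)).1 hle

/-- The root's `Λ`-endpoint is linked to the target's `Λ`-endpoint by any walk between the two boundary
mid-edges. [folklore] -/
theorem linked_root_target {Λ : Finset HexVertex} {u w p q : HexVertex} (hu : u ∉ Λ) (hw : w ∈ Λ)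
    (hp : p ∉ Λ) (γ : HexMidEdgeSAW Λ s(u, w) s(p, q)) : Linked (↑Λ : Set HexVertex) w q := by
  by_cases hnil : γ.verts = []
  · have heq : s(u, w) = s(p, q) := γ.eq_of_nil hnil
    have hq' : q ∈ s(u, w) := by rw [heq]; exact Sym2.mem_mk_right _ _
    rcases Sym2.mem_iff.1 hq' with rfl | rfl
    · have hqΛ : q ∈ Λ := by
        -- `q` is the Λ-endpoint of the target... but here `q = u ∉ Λ`: then `s(u,w) = s(p,u)` forces `w = p ∉ Λ`
        have hw' : w ∈ s(p, q) := by rw [← heq]; exact Sym2.mem_mk_right _ _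
        rcases Sym2.mem_iff.1 hw' with rfl | rfl
        · exact absurd hw hp
        · exact hw
      exact absurd hqΛ hu
    · exact Linked.refl (by exact_mod_cast hw)
  · have hlast : γ.verts.getLast hnil ∈ s(p, q) := γ.getLast_mem _ (List.getLast?_eq_some_getLast hnil)
    have hlastΛ : γ.verts.getLast hnil ∈ Λ := γ.subset _ (List.getLast_mem hnil)
    have hlq : γ.verts.getLast hnil = q := by
      rcases Sym2.mem_iff.1 hlast with h | h
      · exact absurd (h ▸ hlastΛ) hp
      · exact h
    exact hlq ▸ verts_linked hu γ _ (List.getLast_mem hnil)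

/-- **Block 4 holds: the rows clause passes to the root component.** In the frame (flatness, boundary
mid-edges, a SAW, inside, rows clause) plus `b_δ → b`, eventually every vertex of the `ρ`-ball about `b` with
`row ≥ m_δ` lies in the root component `compA (Λ δ) (a δ)`: the discrete half-ball is linked
(`halfball_linked`, with `S = Λ_δ`, centre `b`, float height `η_δ ∈ (0, ρ/2]` read off the endpoint of `b_δ`)
and contains the `Λ`-endpoint of `b_δ`, which the SAW links to the root. [folklore] -/
theorem rowsComp_holds :
    ∀ (D : DobrushinDomain) (ρ : ℝ) (Λ : ℝ → Finset HexVertex) (m : ℝ → ℤ) (a b : ℝ → Sym2 HexVertex),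
    0 < ρ → Flat D ρ → FrameNoConn D ρ Λ m a b → Exhausts D Λ → BLim D b →
      ∀ᶠ δ : ℝ in nhdsWithin 0 (Set.Ioi 0), ∀ v : HexVertex,
        (δ : ℂ) * hexCenter v ∈ Metric.ball (D.pt 1) ρ → (v ∈ compA (Λ δ) (a δ) ↔ m δ ≤ v.1 1) := by
  intro D ρ Λ m a b hρ hflat hfr _hex hb
  have hsmall : ∀ᶠ δ : ℝ in nhdsWithin 0 (Set.Ioi 0), 0 < δ ∧ δ < ρ / 10 := by
    filter_upwards [Ioo_mem_nhdsGT (show (0 : ℝ) < ρ / 10 by positivity)] with δ h using ⟨h.1, h.2⟩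
  have hnear : ∀ᶠ δ : ℝ in nhdsWithin 0 (Set.Ioi 0),
      (δ : ℂ) * hexMidpoint (b δ) ∈ Metric.ball (D.pt 1) (ρ / 4) :=
    hb (Metric.ball_mem_nhds _ (by positivity))
  filter_upwards [hfr, hsmall, hnear] with δ hf hδ' hbn
  obtain ⟨hδ0, hδ1⟩ := hδ'
  obtain ⟨-, haB, hbB, hne, hin, hrows⟩ := hf
  obtain ⟨hae, u, w, hauw, hw, hu⟩ := haB
  obtain ⟨hbe, p', q, hbpq, hq, hp'⟩ := hbB
  have hpq : hexGraph.Adj p' q := by rw [hbpq] at hbe; exact (SimpleGraph.mem_edgeSet _).1 hbe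
  set c : ℂ := D.pt 1 with hc
  -- `q` and `p'` lie in the ball
  rw [Metric.mem_ball, hbpq, hexMidpoint_mk] at hbn
  have hnorm := norm_center_sub_le_one hpq
  have hdq : dist ((δ : ℂ) * hexCenter q) c < ρ / 4 + δ / 2 := by
    have e : (δ : ℂ) * hexCenter q = (δ : ℂ) * ((hexCenter p' + hexCenter q) / 2) +
        (δ : ℂ) * ((hexCenter q - hexCenter p') / 2) := by ring
    rw [e, dist_eq_norm]
    calc ‖(δ : ℂ) * ((hexCenter p' + hexCenter q) / 2) + (δ : ℂ) * ((hexCenter q - hexCenter p') / 2) - c‖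
        = ‖((δ : ℂ) * ((hexCenter p' + hexCenter q) / 2) - c) + (δ : ℂ) * ((hexCenter q - hexCenter p') / 2)‖ := by
          ring_nf
      _ ≤ ‖(δ : ℂ) * ((hexCenter p' + hexCenter q) / 2) - c‖ + ‖(δ : ℂ) * ((hexCenter q - hexCenter p') / 2)‖ :=
          norm_add_le _ _
      _ < ρ / 4 + δ / 2 := by
          apply add_lt_add_of_lt_of_le
          · rwa [dist_eq_norm] at hbn
          · rw [norm_mul, Complex.norm_real, Real.norm_of_nonneg hδ0.le, norm_div,
              show ‖(2 : ℂ)‖ = 2 by simp, norm_sub_rev]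
            nlinarith [norm_nonneg (hexCenter p' - hexCenter q)]
  have hdp : dist ((δ : ℂ) * hexCenter p') c < ρ / 4 + δ / 2 := by
    have e : (δ : ℂ) * hexCenter p' = (δ : ℂ) * ((hexCenter p' + hexCenter q) / 2) +
        (δ : ℂ) * ((hexCenter p' - hexCenter q) / 2) := by ring
    rw [e, dist_eq_norm]
    calc ‖(δ : ℂ) * ((hexCenter p' + hexCenter q) / 2) + (δ : ℂ) * ((hexCenter p' - hexCenter q) / 2) - c‖
        = ‖((δ : ℂ) * ((hexCenter p' + hexCenter q) / 2) - c) + (δ : ℂ) * ((hexCenter p' - hexCenter q) / 2)‖ := by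
          ring_nf
      _ ≤ ‖(δ : ℂ) * ((hexCenter p' + hexCenter q) / 2) - c‖ + ‖(δ : ℂ) * ((hexCenter p' - hexCenter q) / 2)‖ :=
          norm_add_le _ _
      _ < ρ / 4 + δ / 2 := by
          apply add_lt_add_of_lt_of_le
          · rwa [dist_eq_norm] at hbn
          · rw [norm_mul, Complex.norm_real, Real.norm_of_nonneg hδ0.le, norm_div,
              show ‖(2 : ℂ)‖ = 2 by simp]
            nlinarith [norm_nonneg (hexCenter p' - hexCenter q)]
  have hqball : (δ : ℂ) * hexCenter q ∈ Metric.ball c ρ := by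
    rw [Metric.mem_ball]; linarith
  have hpball : (δ : ℂ) * hexCenter p' ∈ Metric.ball c ρ := by
    rw [Metric.mem_ball]; linarith
  -- rows: `row q = m`, `q` is low-type
  have hmq : m δ ≤ row q := (hrows q hqball).1 hq
  have hmp : ¬ m δ ≤ row p' := fun h => hp' ((hrows p' hpball).2 h)
  have hrowq : row q = m δ ∧ (pos q - row q) % 2 = 0 := by
    rcases (adj_iff p' q).1 hpq with ⟨hr, -⟩ | ⟨-, hr, -⟩ | ⟨hp2, hr, hpar⟩
    · omega
    · omega
    · refine ⟨by omega, ?_⟩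
      omega
  obtain ⟨hrowq, hparq⟩ := hrowq
  -- the float height facts
  have hqeq : q = bv (m δ) (pos q) := by rw [← hrowq, bv_row_pos]
  have hparq' : (pos q - m δ) % 2 = 0 := by rw [← hrowq]; exact hparq
  have himq : ((δ : ℂ) * hexCenter q).im = δ * hgt * (((m δ : ℤ) : ℝ) + 1 / 3) := by
    rw [hqeq, im_bv_scaled_even δ hparq']
  have hqD : (δ : ℂ) * hexCenter q ∈ D.carrier ∩ Metric.ball c ρ := ⟨hin q hq, hqball⟩
  have hflat' : D.carrier ∩ Metric.ball c ρ = {z : ℂ | c.im < z.im} ∩ Metric.ball c ρ := hflat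
  rw [hflat'] at hqD
  have hη0 : c.im < δ * hgt * (((m δ : ℤ) : ℝ) + 1 / 3) := by rw [← himq]; exact hqD.1
  have hη1 : δ * hgt * (((m δ : ℤ) : ℝ) + 1 / 3) ≤ c.im + ρ / 2 := by
    have h1 : |((δ : ℂ) * hexCenter q - c).im| ≤ ‖(δ : ℂ) * hexCenter q - c‖ := Complex.abs_im_le_norm _
    rw [Complex.sub_im, himq, abs_le] at h1
    rw [dist_eq_norm] at hdq
    linarith [h1.2]
  have hS : ∀ v : HexVertex, (δ : ℂ) * hexCenter v ∈ Metric.ball c ρ → m δ ≤ row v → v ∈ (↑(Λ δ) : Set HexVertex) :=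
    fun v hv hvm => by exact_mod_cast (hrows v hv).2 hvm
  have hδρ : 10 * δ ≤ ρ := by linarith
  -- conclusion
  intro v hv
  constructor
  · intro hvc
    exact (hrows v hv).1 (mem_compA.1 hvc).1
  · intro hvm
    have hlv := halfball_linked hδ0 hρ hδρ hS hη0 hη1 hv hvm
    have hlq := halfball_linked hδ0 hρ hδρ hS hη0 hη1 hqball hmq
    rw [hauw, hbpq] at hne
    have hwq : Linked (↑(Λ δ) : Set HexVertex) w q := linked_root_target hu hw hp' hne.some
    have hwv : Linked (↑(Λ δ) : Set HexVertex) w v := (hwq.trans hlq).trans hlv.symm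
    rw [hauw, compA_eq_comp hu hw]
    exact mem_comp.2 ⟨by exact_mod_cast hwv.mem_right, hwv⟩

/-! ### M.7 Tools for Block 5: lattice density, brick `L`-paths, a compact connected hull -/

/-- **Lattice density**: every point of the plane is within `δ` of a scaled centre. [folklore] -/
theorem exists_vertex_near {δ : ℝ} (hδ : 0 < δ) (z : ℂ) :
    ∃ v : HexVertex, ‖(δ : ℂ) * hexCenter v - z‖ ≤ δ := by
  have hg1 := hgt_gt
  have hg2 := hgt_lt
  have hh : 0 < δ * hgt := by nlinarith
  -- row: `r + 1/3` within `1/2` of `z.im / (δ hgt)`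
  set r : ℤ := ⌊z.im / (δ * hgt) - 1 / 3 + 1 / 2⌋ with hr
  have hr1 := Int.floor_le (z.im / (δ * hgt) - 1 / 3 + 1 / 2)
  have hr2 := Int.lt_floor_add_one (z.im / (δ * hgt) - 1 / 3 + 1 / 2)
  -- position of parity `r`: `p = r + 2k`, `Re = δ (p+1)/2`
  set k : ℤ := ⌊z.re / δ - ((r : ℝ) + 1) / 2 + 1 / 2⌋ with hk
  have hk1 := Int.floor_le (z.re / δ - ((r : ℝ) + 1) / 2 + 1 / 2)
  have hk2 := Int.lt_floor_add_one (z.re / δ - ((r : ℝ) + 1) / 2 + 1 / 2)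
  refine ⟨bv r (r + 2 * k), ?_⟩
  have hpar : (r + 2 * k - r) % 2 = 0 := by omega
  have hre : ((δ : ℂ) * hexCenter (bv r (r + 2 * k)) - z).re = δ * (((r + 2 * k : ℤ) : ℝ) + 1) / 2 - z.re := by
    rw [Complex.sub_re, re_bv_scaled]
  have him : ((δ : ℂ) * hexCenter (bv r (r + 2 * k)) - z).im = δ * hgt * ((r : ℝ) + 1 / 3) - z.im := by
    rw [Complex.sub_im, im_bv_scaled_even δ hpar]
  have hre' : |((δ : ℂ) * hexCenter (bv r (r + 2 * k)) - z).re| ≤ δ / 2 := by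
    rw [hre, abs_le]
    have e1 : δ * (((r + 2 * k : ℤ) : ℝ) + 1) / 2 - z.re = δ * ((k : ℝ) - (z.re / δ - ((r : ℝ) + 1) / 2)) := by
      push_cast; field_simp; ring
    rw [e1]
    constructor <;> nlinarith
  have him' : |((δ : ℂ) * hexCenter (bv r (r + 2 * k)) - z).im| ≤ δ * hgt / 2 := by
    rw [him, abs_le]
    have e2 : δ * hgt * ((r : ℝ) + 1 / 3) - z.im = δ * hgt * ((r : ℝ) - (z.im / (δ * hgt) - 1 / 3)) := by
      field_simp; ring
    rw [e2]
    constructor <;> nlinarith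
  calc ‖(δ : ℂ) * hexCenter (bv r (r + 2 * k)) - z‖
      ≤ |((δ : ℂ) * hexCenter (bv r (r + 2 * k)) - z).re| + |((δ : ℂ) * hexCenter (bv r (r + 2 * k)) - z).im| :=
        Complex.norm_le_abs_re_add_abs_im _
    _ ≤ δ / 2 + δ * hgt / 2 := add_le_add hre' him'
    _ ≤ δ := by nlinarith

/-- **Brick `L`-path**: if the box of rows between `r₁, r₂` and positions `min(p₁,p₂)-1 … max(p₁,p₂)+1` lies
in `S`, then `bv r₁ p₁` and `bv r₂ p₂` are linked inside `S` (run along row `r₁`, then a vertical band). [folklore] -/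
theorem linked_box {S : Set HexVertex} {r₁ p₁ r₂ p₂ : ℤ}
    (h : ∀ r p : ℤ, min r₁ r₂ ≤ r → r ≤ max r₁ r₂ → min p₁ p₂ - 1 ≤ p → p ≤ max p₁ p₂ + 1 → bv r p ∈ S) :
    Linked S (bv r₁ p₁) (bv r₂ p₂) := by
  -- run along row `r₁` from `p₁` to `p₂`
  have hrun : Linked S (bv r₁ p₁) (bv r₁ p₂) := by
    rcases le_total p₁ p₂ with hle | hle
    · exact linked_run' r₁ p₁ p₂ hle fun t ht1 ht2 =>
        h r₁ t (min_le_left _ _) (le_max_left _ _) (by rw [min_eq_left hle]; omega) (by rw [max_eq_right hle]; omega)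
    · exact (linked_run' r₁ p₂ p₁ hle fun t ht1 ht2 =>
        h r₁ t (min_le_left _ _) (le_max_left _ _) (by rw [min_eq_right hle]; omega) (by rw [max_eq_left hle]; omega)).symm
  -- vertical band at columns `p₂, p₂ + 1`
  have hband : Linked S (bv r₁ p₂) (bv r₂ p₂) := by
    have hcol : ∀ r : ℤ, min r₁ r₂ ≤ r → r ≤ max r₁ r₂ → bv r p₂ ∈ S ∧ bv r (p₂ + 1) ∈ S := fun r h1 h2 =>
      ⟨h r p₂ h1 h2 (by omega) (by omega), h r (p₂ + 1) h1 h2 (by omega) (by omega)⟩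
    rcases le_total r₁ r₂ with hle | hle
    · exact (linked_band p₂ r₁ r₂ hle fun r h1 h2 => hcol r (by rw [min_eq_left hle]; exact h1)
        (by rw [max_eq_right hle]; exact h2)).symm
    · exact linked_band p₂ r₂ r₁ hle fun r h1 h2 => hcol r (by rw [min_eq_right hle]; exact h1)
        (by rw [max_eq_left hle]; exact h2)
  exact hrun.trans hband

/-- Centres of the box are close to its corners: within `|ΔRe| + |ΔIm| + 2δ` of `bv r₁ p₁`. [folklore] -/
theorem dist_box_le {δ : ℝ} (hδ : 0 < δ) {r₁ p₁ r₂ p₂ r p : ℤ} (hr1 : min r₁ r₂ ≤ r) (hr2 : r ≤ max r₁ r₂)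
    (hp1 : min p₁ p₂ - 1 ≤ p) (hp2 : p ≤ max p₁ p₂ + 1) :
    dist ((δ : ℂ) * hexCenter (bv r p)) ((δ : ℂ) * hexCenter (bv r₁ p₁)) ≤
      2 * dist ((δ : ℂ) * hexCenter (bv r₂ p₂)) ((δ : ℂ) * hexCenter (bv r₁ p₁)) + 3 * δ := by
  have hg1 := hgt_gt
  have hg2 := hgt_lt
  set D12 := dist ((δ : ℂ) * hexCenter (bv r₂ p₂)) ((δ : ℂ) * hexCenter (bv r₁ p₁)) with hD12
  have hre12 : |δ * ((p₂ : ℝ) + 1) / 2 - δ * ((p₁ : ℝ) + 1) / 2| ≤ D12 := by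
    have := Complex.abs_re_le_norm ((δ : ℂ) * hexCenter (bv r₂ p₂) - (δ : ℂ) * hexCenter (bv r₁ p₁))
    rwa [Complex.sub_re, re_bv_scaled, re_bv_scaled, ← dist_eq_norm] at this
  have him12 : |((δ : ℂ) * hexCenter (bv r₂ p₂)).im - ((δ : ℂ) * hexCenter (bv r₁ p₁)).im| ≤ D12 := by
    have := Complex.abs_im_le_norm ((δ : ℂ) * hexCenter (bv r₂ p₂) - (δ : ℂ) * hexCenter (bv r₁ p₁))
    rwa [Complex.sub_im, ← dist_eq_norm] at this
  -- imaginary parts: `δ hgt (row + (k+1)/3)`, rows between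
  have himr : ∀ (r p : ℤ), δ * hgt * ((r : ℝ) + 1 / 3) ≤ ((δ : ℂ) * hexCenter (bv r p)).im ∧
      ((δ : ℂ) * hexCenter (bv r p)).im ≤ δ * hgt * ((r : ℝ) + 2 / 3) := by
    intro r p
    rcases Int.emod_two_eq_zero_or_one (p - r) with hq | hq
    · rw [im_bv_scaled_even δ hq]; constructor <;> nlinarith
    · rw [im_bv_scaled_odd δ hq]; constructor <;> nlinarith
  obtain ⟨i1, i2⟩ := himr r p
  obtain ⟨j1, j2⟩ := himr r₁ p₁
  obtain ⟨k1, k2⟩ := himr r₂ p₂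
  rw [dist_eq_norm]
  refine (Complex.norm_le_abs_re_add_abs_im _).trans ?_
  rw [Complex.sub_re, Complex.sub_im, re_bv_scaled, re_bv_scaled]
  have hr1' : ((min r₁ r₂ : ℤ) : ℝ) ≤ r := by exact_mod_cast hr1
  have hr2' : (r : ℝ) ≤ ((max r₁ r₂ : ℤ) : ℝ) := by exact_mod_cast hr2
  have hp1' : ((min p₁ p₂ : ℤ) : ℝ) - 1 ≤ p := by exact_mod_cast hp1
  have hp2' : (p : ℝ) ≤ ((max p₁ p₂ : ℤ) : ℝ) + 1 := by exact_mod_cast hp2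
  rw [abs_le] at hre12 him12
  have hA : |δ * ((p : ℝ) + 1) / 2 - δ * ((p₁ : ℝ) + 1) / 2| ≤ D12 + δ := by
    rw [abs_le]
    rcases le_total p₁ p₂ with hle | hle
    · rw [min_eq_left hle] at hp1'; rw [max_eq_right hle] at hp2'
      have : (p₁ : ℝ) ≤ p₂ := by exact_mod_cast hle
      constructor <;> nlinarith
    · rw [min_eq_right hle] at hp1'; rw [max_eq_left hle] at hp2'
      have : (p₂ : ℝ) ≤ p₁ := by exact_mod_cast hle
      constructor <;> nlinarith
  have hB : |((δ : ℂ) * hexCenter (bv r p)).im - ((δ : ℂ) * hexCenter (bv r₁ p₁)).im| ≤ D12 + 2 * δ := by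
    rw [abs_le]
    have hdh : 0 < δ * hgt := by nlinarith
    rcases le_total r₁ r₂ with hle | hle
    · rw [min_eq_left hle] at hr1'; rw [max_eq_right hle] at hr2'
      have : (r₁ : ℝ) ≤ r₂ := by exact_mod_cast hle
      constructor <;> nlinarith
    · rw [min_eq_right hle] at hr1'; rw [max_eq_left hle] at hr2'
      have : (r₂ : ℝ) ≤ r₁ := by exact_mod_cast hle
      constructor <;> nlinarith
  linarith

/-- **A compact connected hull inside an open connected set**: a compact `K ⊆ U` and a point `z₀ ∈ U` lie in
a compact preconnected `K⁺ ⊆ U` (finite ball cover of `K` plus paths to `z₀`). [folklore] -/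
theorem exists_compact_preconnected_superset {U K : Set ℂ} (hU : IsOpen U) (hUc : IsConnected U)
    (hK : IsCompact K) (hKU : K ⊆ U) {z₀ : ℂ} (hz₀ : z₀ ∈ U) :
    ∃ K' : Set ℂ, IsCompact K' ∧ IsPreconnected K' ∧ K ⊆ K' ∧ z₀ ∈ K' ∧ K' ⊆ U := by
  have hpc : IsPathConnected U := (hU.isConnected_iff_isPathConnected).1 hUc
  obtain ⟨r, hr, hrU⟩ := hK.exists_cthickening_subset_open hU hKU
  obtain ⟨t, htK, htfin, hcover⟩ := finite_cover_balls_of_compact hK (half_pos hr)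
  haveI : Fintype ↥t := htfin.fintype
  -- a path in `U` from `z₀` to each net point
  have hjoin : ∀ x : ↥t, JoinedIn U z₀ x.1 := fun x => hpc.joinedIn z₀ hz₀ x.1 (hKU (htK x.2))
  let γ : ∀ x : ↥t, Path z₀ x.1 := fun x => (hjoin x).somePath
  let S : Option ↥t → Set ℂ := fun o => match o with
    | none => {z₀}
    | some x => Metric.closedBall x.1 (r / 2) ∪ Set.range (γ x)
  refine ⟨⋃ o, S o, ?_, ?_, ?_, ?_, ?_⟩
  · refine isCompact_iUnion fun o => ?_
    cases o with
    | none => exact isCompact_singleton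
    | some x => exact (isCompact_closedBall _ _).union (isCompact_range (γ x).continuous)
  · refine isPreconnected_iUnion ⟨z₀, Set.mem_iInter.2 fun o => ?_⟩ fun o => ?_
    · cases o with
      | none => exact Set.mem_singleton _
      | some x => exact Or.inr ⟨0, (γ x).source⟩
    · cases o with
      | none => exact isPreconnected_singleton
      | some x =>
        refine IsPreconnected.union x.1 (Metric.mem_closedBall_self (half_pos hr).le) ⟨1, (γ x).target⟩
          (convex_closedBall _ _).isPreconnected ?_
        exact (isPreconnected_range (γ x).continuous)
  · intro z hz
    obtain ⟨x, hx, hzx⟩ : ∃ x ∈ t, z ∈ Metric.ball x (r / 2) := by simpa using hcover hz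
    exact Set.mem_iUnion.2 ⟨some ⟨x, hx⟩, Or.inl (Metric.ball_subset_closedBall hzx)⟩
  · exact Set.mem_iUnion.2 ⟨none, Set.mem_singleton _⟩
  · intro z hz
    obtain ⟨o, ho⟩ := Set.mem_iUnion.1 hz
    cases o with
    | none => rw [Set.mem_singleton_iff.1 ho]; exact hz₀
    | some x =>
      rcases ho with ho | ⟨s, rfl⟩
      · refine hrU (Metric.mem_cthickening_of_dist_le z x.1 r K (htK x.2) ?_)
        have := Metric.mem_closedBall.1 ho
        linarith
      · exact (hjoin x).somePath_mem s

/-! ### M.8 Block 5 discharged: exhaustion passes to the root component; `Preconnected` IS DECORATION -/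

/-- **Block 5 holds: exhaustion passes to the root component.** For a compact `K ⊆ D`, take a compact
preconnected hull `K' ⊇ K ∪ {b + iρ/2}` inside `D` and `2ε`... an `ε` with `cthickening ε K' ⊆ D`; the
relation "lattice vertices `δ`-close to `x` and to `y` are linked through vertices whose centres lie in the
thickening" is reflexive-symmetric-transitive and locally true on `K'` (brick `L`-paths in an `ε/8`-ball), hence
total (`IsPreconnected.induction₂'`); exhaustion of the (compact) thickening puts those vertices in `Λ_δ`, and
the vertex next to `b + iρ/2` lies in the root component by Block 4. [folklore] -/
theorem exhaustsComp_holds :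
    ∀ (D : DobrushinDomain) (ρ : ℝ) (Λ : ℝ → Finset HexVertex) (m : ℝ → ℤ) (a b : ℝ → Sym2 HexVertex),
    0 < ρ → Flat D ρ → FrameNoConn D ρ Λ m a b → Exhausts D Λ → BLim D b →
      Exhausts D (fun δ => compA (Λ δ) (a δ)) := by
  intro D ρ Λ m a b hρ hflat hfr hex hb K hK hKD
  have hrc := rowsComp_holds D ρ Λ m a b hρ hflat hfr hex hb
  set c : ℂ := D.pt 1 with hc
  set z₀ : ℂ := c + Complex.I * ((ρ / 2 : ℝ) : ℂ) with hz₀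
  have hz₀c : dist z₀ c = ρ / 2 := by
    rw [dist_eq_norm, show z₀ - c = Complex.I * ((ρ / 2 : ℝ) : ℂ) by rw [hz₀]; ring, norm_mul,
      Complex.norm_I, one_mul, Complex.norm_real, Real.norm_of_nonneg (by positivity)]
  have hz₀ball : z₀ ∈ Metric.ball c ρ := by rw [Metric.mem_ball, hz₀c]; linarith
  have hz₀D : z₀ ∈ D.carrier := by
    have hmem : z₀ ∈ {z : ℂ | c.im < z.im} ∩ Metric.ball c ρ := by
      refine ⟨?_, hz₀ball⟩
      show c.im < z₀.im
      rw [hz₀]; simp; linarith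
    have hflat' : D.carrier ∩ Metric.ball c ρ = {z : ℂ | c.im < z.im} ∩ Metric.ball c ρ := hflat
    rw [← hflat'] at hmem
    exact hmem.1
  -- Step A: a compact preconnected hull of `K ∪ {z₀}` inside `D`, and a closed thickening inside `D`
  obtain ⟨K', hK'c, hK'pc, hKK', hz₀K', hK'D⟩ :=
    exists_compact_preconnected_superset D.isOpen D.isConnected hK hKD hz₀D
  obtain ⟨ε, hε, hεD⟩ := hK'c.exists_cthickening_subset_open D.isOpen hK'D
  set T : Set ℂ := Metric.cthickening ε K' with hT
  have hTc : IsCompact T := hK'c.cthickening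
  have hTD : T ⊆ D.carrier := hεD
  -- Step B: the linking relation on `K'`
  let P : ℂ → ℂ → Prop := fun x y => ∀ δ : ℝ, 0 < δ → 16 * δ ≤ ε → ∀ v₁ v₂ : HexVertex,
      ‖(δ : ℂ) * hexCenter v₁ - x‖ ≤ δ → ‖(δ : ℂ) * hexCenter v₂ - y‖ ≤ δ →
      Linked {u : HexVertex | (δ : ℂ) * hexCenter u ∈ T} v₁ v₂
  have hPsymm : ∀ x y, P x y → P y x := fun x y h δ hδ hδε v₁ v₂ h1 h2 => (h δ hδ hδε v₂ v₁ h2 h1).symm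
  have hPtrans : ∀ x y z, x ∈ K' → y ∈ K' → z ∈ K' → P x y → P y z → P x z := by
    intro x y z _ _ _ hxy hyz δ hδ hδε v₁ v₃ h1 h3
    obtain ⟨v₂, h2⟩ := exists_vertex_near hδ y
    exact (hxy δ hδ hδε v₁ v₂ h1 h2).trans (hyz δ hδ hδε v₂ v₃ h2 h3)
  have hPloc : ∀ x ∈ K', ∀ᶠ y in nhdsWithin x K', P x y ∧ P y x := by
    intro x hx
    have hnb : K' ∩ Metric.ball x (ε / 8) ∈ nhdsWithin x K' :=
      inter_mem_nhdsWithin K' (Metric.ball_mem_nhds x (by positivity))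
    filter_upwards [hnb] with y hy
    have hyx : dist y x < ε / 8 := Metric.mem_ball.1 hy.2
    have key : P x y := by
      intro δ hδ hδε v₁ v₂ h1 h2
      have h12 : dist ((δ : ℂ) * hexCenter v₂) ((δ : ℂ) * hexCenter v₁) ≤ ε / 8 + 2 * δ := by
        have a1 : dist ((δ : ℂ) * hexCenter v₂) y ≤ δ := by rwa [dist_eq_norm]
        have a2 : dist x ((δ : ℂ) * hexCenter v₁) ≤ δ := by rwa [dist_comm, dist_eq_norm]
        have t1 := dist_triangle ((δ : ℂ) * hexCenter v₂) y ((δ : ℂ) * hexCenter v₁)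
        have t2 := dist_triangle y x ((δ : ℂ) * hexCenter v₁)
        linarith
      have h1' : dist ((δ : ℂ) * hexCenter v₁) x ≤ δ := by rwa [dist_eq_norm]
      rw [← bv_row_pos v₁, ← bv_row_pos v₂]
      refine linked_box fun r p hr1 hr2 hp1 hp2 => ?_
      show (δ : ℂ) * hexCenter (bv r p) ∈ T
      apply Metric.thickening_subset_cthickening
      rw [Metric.mem_thickening_iff]
      refine ⟨x, hx, ?_⟩
      have hd := dist_box_le hδ hr1 hr2 hp1 hp2
      rw [bv_row_pos, bv_row_pos] at hd
      calc dist ((δ : ℂ) * hexCenter (bv r p)) x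
          ≤ dist ((δ : ℂ) * hexCenter (bv r p)) ((δ : ℂ) * hexCenter v₁) + dist ((δ : ℂ) * hexCenter v₁) x :=
            dist_triangle _ _ _
        _ ≤ 2 * (ε / 8 + 2 * δ) + 3 * δ + δ := by linarith
        _ < ε := by linarith
    exact ⟨key, hPsymm x y key⟩
  -- Step C: eventually
  have hexT := hex T hTc hTD
  have hsmall : ∀ᶠ δ : ℝ in nhdsWithin 0 (Set.Ioi 0), 0 < δ ∧ δ < min (ε / 16) (ρ / 4) := by
    filter_upwards [Ioo_mem_nhdsGT (show (0 : ℝ) < min (ε / 16) (ρ / 4) by positivity)] with δ h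
      using ⟨h.1, h.2⟩
  filter_upwards [hexT, hsmall, hrc, hfr] with δ hΛT hδ hcomp hf
  obtain ⟨hδ0, hδ1⟩ := hδ
  have hδε : 16 * δ ≤ ε := by have := min_le_left (ε / 16) (ρ / 4); linarith
  have hδρ : δ < ρ / 4 := lt_of_lt_of_le hδ1 (min_le_right _ _)
  intro v hvK
  obtain ⟨uz, huz⟩ := exists_vertex_near hδ0 z₀
  -- the chain argument
  have hP : P ((δ : ℂ) * hexCenter v) z₀ := hK'pc.induction₂' P hPloc hPtrans (hKK' hvK) hz₀K'
  have hlink : Linked {u : HexVertex | (δ : ℂ) * hexCenter u ∈ T} v uz :=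
    hP δ hδ0 hδε v uz (by rw [sub_self, norm_zero]; exact hδ0.le) huz
  have hlinkΛ : Linked (↑(Λ δ) : Set HexVertex) v uz :=
    hlink.mono fun w hw => by exact_mod_cast hΛT w hw
  -- `uz` lies in the root component (Block 4)
  have huzball : (δ : ℂ) * hexCenter uz ∈ Metric.ball c ρ := by
    rw [Metric.mem_ball]
    calc dist ((δ : ℂ) * hexCenter uz) c ≤ dist ((δ : ℂ) * hexCenter uz) z₀ + dist z₀ c := dist_triangle _ _ _
      _ ≤ δ + ρ / 2 := by rw [dist_eq_norm, hz₀c]; linarith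
      _ < ρ := by linarith
  have huzT : (δ : ℂ) * hexCenter uz ∈ T :=
    Metric.mem_cthickening_of_dist_le _ z₀ ε K' hz₀K' (by rw [dist_eq_norm]; linarith)
  have huzΛ : uz ∈ Λ δ := hΛT uz huzT
  obtain ⟨-, haB, -, -, -, hrows⟩ := hf
  have hum : m δ ≤ row uz := (hrows uz huzball).1 huzΛ
  have huzc : uz ∈ compA (Λ δ) (a δ) := (hcomp uz huzball).2 hum
  obtain ⟨-, u, w, hauw, hw, hu⟩ := haB
  rw [hauw, compA_eq_comp hu hw] at huzc ⊢
  have hwuz : Linked (↑(Λ δ) : Set HexVertex) w uz := (mem_comp.1 huzc).2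
  have hwv := hwuz.trans hlinkΛ.symm
  exact mem_comp.2 ⟨by exact_mod_cast hwv.mem_right, hwv⟩

/-- **`Preconnected` is decoration**: at every cut `c` and all spins, the crux implies its `Preconnected`-free
strengthening — apply the crux to the root component (frame by `rowsComp_holds`, exhaustion by `exhaustsComp_holds`)
and transport the conclusion back with `observable_comp_eq` / `finsum_comp_eq`. [folklore] -/
theorem massRatioAt_withoutPreconnected_of_massRatioAt {c σ τ : ℝ}
    (h : MassRatioAt c σ τ) : MassRatioAtWithoutPreconnected c σ τ := by
  intro D ρ Λ m a b hρ hflat hfr hex ha hb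
  set Λ' : ℝ → Finset HexVertex := fun δ => compA (Λ δ) (a δ) with hΛ'
  -- the frame of the component family
  have hrows' := rowsComp_holds D ρ Λ m a b hρ hflat hfr hex hb
  have hframe' : Frame D ρ Λ' m a b := by
    filter_upwards [hfr, hrows'] with δ hf hr
    obtain ⟨hsc, haB, hbB, hne, hin, -⟩ := hf
    obtain ⟨hae, u, w, hauw, hw, hu⟩ := haB
    have huw : hexGraph.Adj u w := by rw [hauw] at hae; exact (SimpleGraph.mem_edgeSet _).1 hae
    have hcomp : Λ' δ = comp (Λ δ) w := by
      show compA (Λ δ) (a δ) = comp (Λ δ) w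
      rw [hauw]; exact compA_eq_comp hu hw
    refine ⟨?_, ?_, ?_, ?_, ?_, ?_, hr⟩
    · rw [hcomp]; exact simplyConnected_comp hsc w
    · rw [hcomp, hauw]; exact root_mem_boundary_comp hu hw huw
    · obtain ⟨hbe, p, q, hbpq, hq, hp⟩ := hbB
      have hpq : hexGraph.Adj p q := by rw [hbpq] at hbe; exact (SimpleGraph.mem_edgeSet _).1 hbe
      rw [hcomp, hbpq]
      rw [hauw, hbpq] at hne
      exact target_mem_boundary_comp hu hw hp hq hpq hne.some
    · rw [hcomp]
      rw [hauw] at hne ⊢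
      exact nonempty_saw_comp hu hw huw hne
    · rw [hcomp]; exact preconnected_comp (Λ δ) w
    · intro v hv
      exact hin v (by
        have : v ∈ compA (Λ δ) (a δ) := hv
        exact (mem_compA.1 this).1)
  have hex' : Exhausts D Λ' := exhaustsComp_holds D ρ Λ m a b hρ hflat hfr hex hb
  -- apply the crux to the component family and transport the conclusion back
  intro K hK hKD
  obtain ⟨C, hC⟩ := h D ρ Λ' m a b hρ hflat hframe' hex' ha hb K hK hKD
  refine ⟨C, ?_⟩
  filter_upwards [hC, hfr] with δ hδ hf
  obtain ⟨-, haB, -, -, -, -⟩ := hf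
  obtain ⟨hae, u, w, hauw, hw, hu⟩ := haB
  have huw : hexGraph.Adj u w := by rw [hauw] at hae; exact (SimpleGraph.mem_edgeSet _).1 hae
  have hcomp : Λ' δ = comp (Λ δ) w := by
    show compA (Λ δ) (a δ) = comp (Λ δ) w
    rw [hauw]; exact compA_eq_comp hu hw
  rw [hcomp, hauw] at hδ
  rw [hauw]
  have key := finsum_comp_eq hu hw huw hexCriticalFugacity σ (fun e => (δ : ℂ) * hexMidpoint e ∈ K)
  dsimp only [Set.mem_setOf_eq] at key hδ ⊢
  rwa [key, observable_comp_eq hu hw huw] at hδ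

/-- **`Preconnected` IS DECORATION**: at every cut and all spins, the crux with the `Preconnected` conjunct
deleted is EQUIVALENT to the crux (the other hypotheses — boundary root, SAW, rows clause, exhaustion, `b_δ → b`
— let one restrict to the root component without changing any observable). [folklore] -/

theorem massRatioAt_withoutPreconnected_iff {c σ τ : ℝ} :
    MassRatioAtWithoutPreconnected c σ τ ↔ MassRatioAt c σ τ :=
  ⟨massRatioAt_of_withoutPreconnected, massRatioAt_withoutPreconnected_of_massRatioAt⟩

/-- In particular for the crux itself (`c = 3/4`, `σ = τ = 0`). [folklore] -/
theorem massRatio_iff_withoutPreconnected : MassRatio ↔ MassRatioAtWithoutPreconnected (3 / 4) 0 0 :=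
  massRatio_iff_at.trans massRatioAt_withoutPreconnected_iff.symm

/-! ### M.9 The `Nonempty`-SAW clause is decoration at every cut (cf. `nonempty_saw_of_preconnected`, §K.5) -/

/-- The frame of the crux WITHOUT the `Nonempty`-SAW conjunct. [folklore] -/
def FrameNoSAW (D : DobrushinDomain) (ρ : ℝ) (Λ : ℝ → Finset HexVertex) (m : ℝ → ℤ)
    (a b : ℝ → Sym2 HexVertex) : Prop :=
  ∀ᶠ δ : ℝ in nhdsWithin 0 (Set.Ioi 0), hexDomainSimplyConnected (Λ δ) ∧
    a δ ∈ hexDomainBoundary (Λ δ) ∧ b δ ∈ hexDomainBoundary (Λ δ) ∧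
    (hexGraph.induce ((Λ δ : Finset HexVertex) : Set HexVertex)).Preconnected ∧
    (∀ v ∈ Λ δ, (δ : ℂ) * hexCenter v ∈ D.carrier) ∧
    (∀ v : HexVertex, (δ : ℂ) * hexCenter v ∈ Metric.ball (D.pt 1) ρ → (v ∈ Λ δ ↔ m δ ≤ v.1 1))

/-- The crux at cut `c` with the `Nonempty`-SAW conjunct deleted (a strengthening). [folklore] -/
def MassRatioAtWithoutNonempty (c σ τ : ℝ) : Prop :=
  ∀ (D : DobrushinDomain) (ρ : ℝ) (Λ : ℝ → Finset HexVertex) (m : ℝ → ℤ) (a b : ℝ → Sym2 HexVertex),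
    0 < ρ → Flat D ρ → FrameNoSAW D ρ Λ m a b → Exhausts D Λ → ALim D a → BLim D b →
      Conclusion c σ τ D Λ a b

/-- Distinct limits force `a_δ ≠ b_δ` eventually. [folklore] -/
theorem eventually_ne_of_lims {D : DobrushinDomain} {a b : ℝ → Sym2 HexVertex} (ha : ALim D a)
    (hb : BLim D b) : ∀ᶠ δ : ℝ in nhdsWithin 0 (Set.Ioi 0), a δ ≠ b δ := by
  have hne : D.pt 0 ≠ D.pt 1 := fun h => by
    have := D.pt_injective h
    exact absurd this (by decide)
  obtain ⟨U, V, hU, hV, h0, h1, hUV⟩ := t2_separation hne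
  have hA : ∀ᶠ δ : ℝ in nhdsWithin 0 (Set.Ioi 0), (δ : ℂ) * hexMidpoint (a δ) ∈ U := ha (hU.mem_nhds h0)
  have hB : ∀ᶠ δ : ℝ in nhdsWithin 0 (Set.Ioi 0), (δ : ℂ) * hexMidpoint (b δ) ∈ V := hb (hV.mem_nhds h1)
  filter_upwards [hA, hB] with δ hδa hδb heq
  rw [heq] at hδa
  exact Set.disjoint_left.1 hUV hδa hδb

/-- **The `Nonempty`-SAW clause is decoration, at every cut and all spins.** [folklore] -/
theorem massRatioAt_withoutNonempty_iff {c σ τ : ℝ} :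
    MassRatioAtWithoutNonempty c σ τ ↔ MassRatioAt c σ τ := by
  constructor
  · intro h D ρ Λ m a b hρ hflat hfr hex ha hb
    exact h D ρ Λ m a b hρ hflat (hfr.mono fun _ hδ =>
      ⟨hδ.1, hδ.2.1, hδ.2.2.1, hδ.2.2.2.2.1, hδ.2.2.2.2.2.1, hδ.2.2.2.2.2.2⟩) hex ha hb
  · intro h D ρ Λ m a b hρ hflat hfr hex ha hb
    refine h D ρ Λ m a b hρ hflat ?_ hex ha hb
    filter_upwards [hfr, eventually_ne_of_lims ha hb] with δ hf hab
    obtain ⟨hsc, haB, hbB, hpre, hin, hrows⟩ := hf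
    refine ⟨hsc, haB, hbB, ?_, hpre, hin, hrows⟩
    obtain ⟨hae, u, w, hauw, hw, hu⟩ := haB
    obtain ⟨hbe, u', v', hbuv, hv', hu'⟩ := hbB
    have huw : hexGraph.Adj u w := by rw [hauw] at hae; exact (SimpleGraph.mem_edgeSet _).1 hae
    have hb' : b δ = s(v', u') := by rw [hbuv, Sym2.eq_swap]
    rw [hauw, hb']
    refine nonempty_saw_of_preconnected hpre huw hu hw hv' hu' ?_
    rw [← hauw, ← hb']
    exact hab

/-- In particular for the crux itself. [folklore] -/
theorem massRatio_iff_withoutNonempty : MassRatio ↔ MassRatioAtWithoutNonempty (3 / 4) 0 0 :=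
  massRatio_iff_at.trans massRatioAt_withoutNonempty_iff.symm

/-! ### M.10 Half of flatness is forced: the lower half-ball about `b` misses `D` -/

/-- **The lower half-ball about `b` misses `D`** (flatness, lower half, is forced by the frame). [folklore] -/
theorem lower_halfball_empty {D : DobrushinDomain} {ρ : ℝ} {Λ : ℝ → Finset HexVertex} {m : ℝ → ℤ}
    {a b : ℝ → Sym2 HexVertex} (hρ : 0 < ρ) (hfr : FrameNoConn D ρ Λ m a b) (hex : Exhausts D Λ)
    (hb : BLim D b) {z : ℂ} (hzD : z ∈ D.carrier) (hzb : z ∈ Metric.ball (D.pt 1) ρ) :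
    (D.pt 1).im ≤ z.im := by
  by_contra hlt
  rw [not_le] at hlt
  set c : ℂ := D.pt 1 with hc
  set η : ℝ := c.im - z.im with hη
  have hη0 : 0 < η := by rw [hη]; linarith
  have hzc : dist z c < ρ := Metric.mem_ball.1 hzb
  -- a closed ball about `z` inside `D`, below the line, inside the `ρ`-ball
  obtain ⟨r', hr', hball⟩ := Metric.isOpen_iff.1 D.isOpen z hzD
  set r : ℝ := min (r' / 2) (min (η / 2) ((ρ - dist z c) / 2)) with hr
  have hr0 : 0 < r := by
    rw [hr]; refine lt_min (by linarith) (lt_min (by linarith) (by linarith))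
  have hrr' : r ≤ r' / 2 := min_le_left _ _
  have hrη : r ≤ η / 2 := (min_le_right _ _).trans (min_le_left _ _)
  have hrρ : r ≤ (ρ - dist z c) / 2 := (min_le_right _ _).trans (min_le_right _ _)
  have hK0D : Metric.closedBall z r ⊆ D.carrier := fun y hy =>
    hball (Metric.mem_ball.2 (lt_of_le_of_lt (Metric.mem_closedBall.1 hy) (by linarith)))
  have hexK := hex (Metric.closedBall z r) (isCompact_closedBall _ _) hK0D
  have hnear : ∀ᶠ δ : ℝ in nhdsWithin 0 (Set.Ioi 0),
      (δ : ℂ) * hexMidpoint (b δ) ∈ Metric.ball c (min ρ η / 4) :=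
    hb (Metric.ball_mem_nhds _ (by positivity))
  have hsmall : ∀ᶠ δ : ℝ in nhdsWithin 0 (Set.Ioi 0), 0 < δ ∧ δ < min r (min (η / 8) (ρ / 10)) := by
    filter_upwards [Ioo_mem_nhdsGT (show (0 : ℝ) < min r (min (η / 8) (ρ / 10)) by positivity)] with δ h
      using ⟨h.1, h.2⟩
  obtain ⟨δ, hf, hΛK, hbn, hδ0, hδ1⟩ := (hfr.and (hexK.and (hnear.and hsmall))).exists
  have hδr : δ < r := lt_of_lt_of_le hδ1 (min_le_left _ _)
  have hδη : δ < η / 8 := lt_of_lt_of_le hδ1 ((min_le_right _ _).trans (min_le_left _ _))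
  have hδρ : δ < ρ / 10 := lt_of_lt_of_le hδ1 ((min_le_right _ _).trans (min_le_right _ _))
  obtain ⟨-, -, hbB, -, hin, hrows⟩ := hf
  -- a lattice vertex near `z`, inside `K₀`, hence in `Λ δ`, in the ball, of row `≥ m δ`
  obtain ⟨v₀, hv₀⟩ := exists_vertex_near hδ0 z
  have hv₀K : (δ : ℂ) * hexCenter v₀ ∈ Metric.closedBall z r :=
    Metric.mem_closedBall.2 (by rw [dist_eq_norm]; linarith)
  have hv₀Λ : v₀ ∈ Λ δ := hΛK v₀ hv₀K
  have hv₀ball : (δ : ℂ) * hexCenter v₀ ∈ Metric.ball c ρ := by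
    rw [Metric.mem_ball]
    calc dist ((δ : ℂ) * hexCenter v₀) c ≤ dist ((δ : ℂ) * hexCenter v₀) z + dist z c := dist_triangle _ _ _
      _ ≤ δ + dist z c := by rw [dist_eq_norm]; linarith
      _ < ρ := by linarith
  have hmv₀ : m δ ≤ row v₀ := (hrows v₀ hv₀ball).1 hv₀Λ
  have himv₀ : ((δ : ℂ) * hexCenter v₀).im ≤ z.im + δ := by
    have h1 : |((δ : ℂ) * hexCenter v₀ - z).im| ≤ ‖(δ : ℂ) * hexCenter v₀ - z‖ := Complex.abs_im_le_norm _
    rw [Complex.sub_im, abs_le] at h1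
    linarith [h1.2]
  have himv₀' : δ * hgt * (((m δ : ℤ) : ℝ) + 1 / 3) ≤ ((δ : ℂ) * hexCenter v₀).im := by
    have h1 := im_scaled_ge δ hδ0.le v₀
    have hg := hgt_gt
    have hm : ((m δ : ℤ) : ℝ) ≤ row v₀ := by exact_mod_cast hmv₀
    nlinarith [mul_pos hδ0 (show (0 : ℝ) < hgt by linarith)]
  -- the endpoint `q` of `b δ`: low-type of row `m δ`, with `Im (δ c_q)` close to `Im c`
  obtain ⟨hbe, p', q, hbpq, hq, hp'⟩ := hbB
  have hpq : hexGraph.Adj p' q := by rw [hbpq] at hbe; exact (SimpleGraph.mem_edgeSet _).1 hbe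
  rw [Metric.mem_ball, hbpq, hexMidpoint_mk] at hbn
  have hmin4 : min ρ η / 4 ≤ ρ / 4 := by have := min_le_left ρ η; linarith
  have hmin4' : min ρ η / 4 ≤ η / 4 := by have := min_le_right ρ η; linarith
  have hnorm := norm_center_sub_le_one hpq
  have hdq : dist ((δ : ℂ) * hexCenter q) c < min ρ η / 4 + δ / 2 := by
    have e : (δ : ℂ) * hexCenter q = (δ : ℂ) * ((hexCenter p' + hexCenter q) / 2) +
        (δ : ℂ) * ((hexCenter q - hexCenter p') / 2) := by ring
    rw [e, dist_eq_norm]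
    calc ‖(δ : ℂ) * ((hexCenter p' + hexCenter q) / 2) + (δ : ℂ) * ((hexCenter q - hexCenter p') / 2) - c‖
        = ‖((δ : ℂ) * ((hexCenter p' + hexCenter q) / 2) - c) + (δ : ℂ) * ((hexCenter q - hexCenter p') / 2)‖ := by
          ring_nf
      _ ≤ ‖(δ : ℂ) * ((hexCenter p' + hexCenter q) / 2) - c‖ + ‖(δ : ℂ) * ((hexCenter q - hexCenter p') / 2)‖ :=
          norm_add_le _ _
      _ < min ρ η / 4 + δ / 2 := by
          apply add_lt_add_of_lt_of_le
          · rwa [dist_eq_norm] at hbn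
          · rw [norm_mul, Complex.norm_real, Real.norm_of_nonneg hδ0.le, norm_div,
              show ‖(2 : ℂ)‖ = 2 by simp, norm_sub_rev]
            nlinarith [norm_nonneg (hexCenter p' - hexCenter q)]
  have hdp : dist ((δ : ℂ) * hexCenter p') c < min ρ η / 4 + δ / 2 := by
    have e : (δ : ℂ) * hexCenter p' = (δ : ℂ) * ((hexCenter p' + hexCenter q) / 2) +
        (δ : ℂ) * ((hexCenter p' - hexCenter q) / 2) := by ring
    rw [e, dist_eq_norm]
    calc ‖(δ : ℂ) * ((hexCenter p' + hexCenter q) / 2) + (δ : ℂ) * ((hexCenter p' - hexCenter q) / 2) - c‖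
        = ‖((δ : ℂ) * ((hexCenter p' + hexCenter q) / 2) - c) + (δ : ℂ) * ((hexCenter p' - hexCenter q) / 2)‖ := by
          ring_nf
      _ ≤ ‖(δ : ℂ) * ((hexCenter p' + hexCenter q) / 2) - c‖ + ‖(δ : ℂ) * ((hexCenter p' - hexCenter q) / 2)‖ :=
          norm_add_le _ _
      _ < min ρ η / 4 + δ / 2 := by
          apply add_lt_add_of_lt_of_le
          · rwa [dist_eq_norm] at hbn
          · rw [norm_mul, Complex.norm_real, Real.norm_of_nonneg hδ0.le, norm_div,
              show ‖(2 : ℂ)‖ = 2 by simp]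
            nlinarith [norm_nonneg (hexCenter p' - hexCenter q)]
  have hqball : (δ : ℂ) * hexCenter q ∈ Metric.ball c ρ := by rw [Metric.mem_ball]; linarith
  have hpball : (δ : ℂ) * hexCenter p' ∈ Metric.ball c ρ := by rw [Metric.mem_ball]; linarith
  have hmq : m δ ≤ row q := (hrows q hqball).1 hq
  have hmp : ¬ m δ ≤ row p' := fun h => hp' ((hrows p' hpball).2 h)
  have hrowq : row q = m δ ∧ (pos q - row q) % 2 = 0 := by
    rcases (adj_iff p' q).1 hpq with ⟨hr, -⟩ | ⟨-, hr, -⟩ | ⟨hp2, hr, hpar⟩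
    · omega
    · omega
    · exact ⟨by omega, by omega⟩
  obtain ⟨hrowq, hparq⟩ := hrowq
  have hqeq : q = bv (m δ) (pos q) := by rw [← hrowq, bv_row_pos]
  have hparq' : (pos q - m δ) % 2 = 0 := by rw [← hrowq]; exact hparq
  have himq : ((δ : ℂ) * hexCenter q).im = δ * hgt * (((m δ : ℤ) : ℝ) + 1 / 3) := by
    rw [hqeq, im_bv_scaled_even δ hparq']
  have himq' : c.im - (η / 4 + δ / 2) < ((δ : ℂ) * hexCenter q).im := by
    have h1 : |((δ : ℂ) * hexCenter q - c).im| ≤ ‖(δ : ℂ) * hexCenter q - c‖ := Complex.abs_im_le_norm _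
    rw [Complex.sub_im, abs_le] at h1
    rw [dist_eq_norm] at hdq
    linarith [h1.1]
  -- contradiction: `Im (δ c_{v₀}) ≥ Im (δ c_q) > c.im - η/4 - δ/2` but `≤ z.im + δ = c.im - η + δ`
  rw [himq] at himq'
  have : c.im - (η / 4 + δ / 2) < z.im + δ := lt_of_lt_of_le himq' (himv₀'.trans himv₀)
  rw [hη] at this hδη
  linarith

end Summit.CriticalPhenomena.SAWScalingLimit.Cruxes.MassRatio.Disproof
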